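import Literature.MathematicalPhysics.QuantumFieldTheory.Balaban1983to89.B3GkZeroLattice
import Literature.MathematicalPhysics.QuantumFieldTheory.Balaban1983to89.B3Ineq210ZeroBox

/-!
# `Balaban1983to89.B3Ineq210ZeroLattice` — T. Bałaban, *(Higgs)₂,₃ quantum fields in a finite volume. III. Renormalization*,
# Commun. Math. Phys. **88** (1983) 411–445 [Balaban1983Higgs3]: the decomposition (2.6) p. 424 and the propagator bound
# (2.10) p. 426 FOR THE PRINT'S OWN §3 PROPAGATOR — the infinite-volume zero-field propagator `G_k(0) = G_k(ηℤ^{d+1}, 0)`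
# of p. 433 (*"with the scalar field propagator equal to G_k(0)"*), to which p. 434 applies (2.6) (*"We apply the
# decomposition (2.6) to the propagators G_k(0), G_k"*): the scale pieces `G^η_{(j)}(0)`, `0 ≤ j ≤ k − 1`, CONSTRUCTED on
# `ηℤ^{d+1}` as the infinite-volume limits of the box pieces, `Σ_j G^η_{(j)}(0) = G_k(0)` PROVED, and r15's decl of record
# `B3Sect2StatementsPart2.ScaledKernels.Ineq210 δ₁ C` DISCHARGED for the concrete carrier `zeroLatticeKernels`

statement-level skeleton of published theorems with citation tags; proofs where landed; nothing here is a claim about the Yang–Mills mass gap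

PDF held: `paper:balaban1983-higgs-2-3-quantum-fields-finite-volume` (journal page = PDF page + 410); p. 424 [PDF 14] ((2.5)–(2.6)),
p. 426 [PDF 16] ((2.10)–(2.12)), p. 433 [PDF 23] (the reductions ending with *"we substitute G_k(□,0) = G_k(0) + δG_k(□,ηZ^d,0)"*),
p. 434 [PDF 24] (*"We apply the decomposition (2.6) to the propagators G_k(0), G_k"*) read in the OCR text (`p0023.txt`, `p0024.txt`)
and on the render `run/shared/lean/pub/pub-balaban/b2b-balaban-ref1/pages/1983-cmp88-higgs23-III/1983-cmp88-higgs23-III-p025-x2.png`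
((3.9): the §3 expressions are built from the pieces `G_{(j)}(0)`, `G_{(j′)}`).

CITATION HEADER (lean-in-tree rule).  Part of the lit-balaban TYPED SKELETON (HOME `run/shared/lean/pub/lit-balaban/`), Phase 2:
SKELETON rows **B3.Eq2.10** (decl of record `B3Sect2StatementsPart2.ScaledKernels.Ineq210`, fold owner r15; head `proved` on the
regular-background torus/region members) and **B3.Eq2.6** — the LOCATED MEMBER «zero field, `Ω = ηℤ^{d+1}`», i.e. the §3 case of
the print; also row **B3.Txt@433** (the p. 433 reduction to `G_k(0)`).  It closes the HONEST-SCOPE item (ii) of p03 g8's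
`B3GkZeroLattice` (*"the scale decomposition (2.6) of `G_k(0)` into pieces `G^η_{(j)}(0)` [is] NOT claimed"*).  Lineage used BY
NAME, nothing re-proved: p03 g8 `B3GkZeroLattice` (centred cubes `cubeM`/`ctr`, label radii `LabRad`, `margin_ctr`, the cube
propagators `gcube` and `G_k(0) = GkLat`, `green_GkLat`), gen-6 `B3DeltaGkZeroNest.abs_dGk_le` (the (2.5) value clause for nested
boxes = the Cauchy estimate), p03 g4 `B3Ineq210ZeroBox` (the box pieces `piece` and the box-uniform (2.10) clauses `abs_piece_le` /
`abs_pieceDiff_le`), the pub-balaban `B4Thm110ZeroBox` calculus (`Gfine`, `Gfine_apply`, `fineOp_top`, `ej`, `sc`, `bj`, `Mj`).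

WHAT IS PRINTED.  p. 424 [PDF 14], (2.6): *"G_k(Ω, B̃) = C^{(0),η}(Ω, B̃) + Σ_{j=1}^{k−1} a_j²(L^jη)^{−4}G^η_j(Ω, B̃)Q_j^*(B̃)C^{(j),L^jη}(Ω, B̃)
Q_j(B̃)G^η_j(Ω, B̃) = Σ_{j=0}^{k−1} G^η_{(j)}(Ω, B̃)"*; p. 426 [PDF 16], (2.10): *"For the propagators G^η_{(j)} we apply the inequality
|G^η_{(j)}(Ω, B̃; x, x′)| ≤ O(1)(L^jη)^{−d+2}e^{−δ₁(L^jη)^{−1}|x−x′|}, (2.10) and if the propagator is differentiated, then for each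
differentiation, there is an additional factor (L^jη)^{−1} on the right side. … These inequalities will be used in the next
chapter."*; p. 433 [PDF 23]: *"Finally we replace the scalar field propagator G_k(□,0) by G_k(0), i.e. we substitute G_k(□,0) =
G_k(0) + δG_k(□,ηZ^d,0) and we treat δG_k as an external scalar field. After all these operations we get a sum of the expressions
… with the same graphical description as before, but with the scalar field propagator equal to G_k(0)."*; p. 434 [PDF 24]: *"We
apply the decomposition (2.6) to the propagators G_k(0), G_k and we get … (3.4)"*.

WHAT IS REPRODUCED, and how (kind «model-instance / infrastructure», G.1 of `HOME/PHASE2-TARGETS.md`).  Counting («matrix units»)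
normalisation of the zero-field lineage throughout (`η = L^{−k}`, `L = ℓ + 1 ≥ 2`, `L^k` fine points per unit block; physical kernels
`= η^{−(d+1)}·(matrix units)`); window `a ∈ [a₋,a₊]` (`a₋ > 0`), `m² ∈ [0,m²₊]`, running `a_j = B1.aSeq a L j`.
* §1 SCALE BOOKKEEPING: the nesting `C_t ⊂ C_{t+e}` of p03's centred cubes READ WITH `L^jη`-BLOCKS (`fits_cubeJ`, offset
  `shiftJ = L^{k−j}e`, the same fine translation `L^k e`: `fine_shiftJ_eq`), *coarser block labels are closer*
  (`supNorm_blk_sub_blk_le_supNorm`), hence **MARGIN TRANSFER** `marginJ_of_margin`: p03's scale-`k` label margin of a centred point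
  (`margin_ctr`) is a scale-`j` label margin for the same nesting;
* §2 THE SCALE PROPAGATORS `𝒢_j = G^η_j(C_t,0) = (−Δ^{η,N} + m² + a_j(L^jη)^{−2}P_j)^{−1}` ([B4] (2.34); `B4Thm110ZeroBox.Gfine ℓ k (cubeM t) j`)
  read on `ℤ^{d+1}` (`gscale`; `gscale_top`: `j = k` is p03's `gcube`), the identification `𝒢_j(□) = s_j^{−2}·G_j(□^{(j)},0)` with
  the TOP-SCALE propagator of the same box measured in `L^jη`-blocks, mass `m²s_j^{−2} ≤ m²` (`Gfine_eq_top_scaleJ`, = [B4] (2.44) /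
  `Gfine_apply`), **THE CAUCHY ESTIMATE** `abs_gscale_sub_le`: `η^{−(d+1)}|g^{(j)}_{t+e} − g^{(j)}_t|(x,x′) ≤ C·s_j^{d+1}s_j^{−2}·
  e^{−δ₀(t−R)}·e^{−δ₀η|x−x′|_∞}` for points of label radius `≤ R`, `t ≥ R + 3`, uniformly in `e`, `k`, `1 ≤ j ≤ k` and the window
  (gen-6's `abs_dGk_le` AT SCALE `j` with the transferred margin), hence `tendsto_gscale` — **the limits `𝒢_j(ηℤ^{d+1}) = GscaleLat`
  EXIST** for `1 ≤ j ≤ k` (`GscaleLat_top`: `𝒢_k(ηℤ^{d+1}) = G_k(0) = B3GkZeroLattice.GkLat` by `rfl`), with the rate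
  `abs_GscaleLat_sub_gscale_le` and symmetry `GscaleLat_comm`;
* §3 **THE LATTICE PIECES** `pieceLat`: `G^η_{(0)}(0) = 𝒢_1(ηℤ^{d+1})`, `G^η_{(j)}(0) = 𝒢_{j+1}(ηℤ^{d+1}) − 𝒢_j(ηℤ^{d+1})` (`1 ≤ j ≤ k − 1`),
  `0` for `j ≥ k`; they ARE the limits of p03 g4's box pieces along the cubes (`pieceCube`, `tendsto_pieceCube`), symmetric
  (`pieceLat_comm`); **(2.6) FOR `G_k(0)`**: `sum_pieceLat : Σ_{j<k} G^η_{(j)}(0) = G_k(0)` on all of `ℤ^{d+1} × ℤ^{d+1}`, and with p03's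
  lattice Green identity `green_sum_pieceLat : Σ_z H(x,z)·Σ_{j<k}G^η_{(j)}(0)(z,x′) = δ_{x,x′}`, `H = −Δ^η + m² + a_kQ_k^*Q_k` on the whole
  lattice in matrix units (`B3GkZeroLattice.latOpK`);
* §4 **(2.10) FOR THE LATTICE PIECES**, value (`abs_pieceLat_le`: `|G^η_{(j)}(0)(x,x′)| ≤ C·L^{−j(d+1)}(L^jη)²e^{−δ₁|x−x′|_∞/L^j}`) and
  derivative (`abs_pieceLatDiff_le`: `L^k|G^η_{(j)}(0)(x+e_μ,x′) − G^η_{(j)}(0)(x,x′)| ≤ C·L^{−j(d+1)}(L^jη)e^{−δ₁|x−x′|_∞/L^j}`, EVERY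
  bond — the lattice has no boundary) for ALL `x, x′ ∈ ℤ^{d+1}`, `k ≥ 1`, `j < k`, uniformly: p03 g4's box clauses, whose constants
  do not see the box, passed to the limit (`le_of_tendsto`);
* §5 the concrete carrier `zeroLatticeKernels d ℓ k hℓ a m2 : ScaledKernels` (`Site = ℤ^{d+1}`, `dist = η|·|_∞`, `absG`/`absDG` the
  pieces in the print's `η^d`-normalisation, the (2.5)/(2.11)/(2.12) fields not modelled — as `B3Ineq210ZeroBox.zeroBoxKernels`) and
  **`ineq210_zeroLattice`**: `∃ δ₁ C > 0` (on `d`, `L`, the window) `∀ k ≥ 1`, window: `(zeroLatticeKernels …).Ineq210 δ₁ C`;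
  §6 `ineq210_zeroLattice_witness` (non-vacuity: `d + 1 = 3`, `L = 2`, `k = 1`, `a = 1`, `m² = 0`).

HONEST SCOPE / DECLARED DIVERGENCES (F7).  (i) Zero background field only (`U ≡ 1`, one component) on the whole lattice
`ηℤ^{d+1}` — the printed §3 case AFTER the p. 433 gauge step removing `B̃₀`; the general statement of (2.6)/(2.10) for `G_k(Ω,B̃)`
(regions `Ω ⊂ T_η`, regular `B̃`) is served by the lineage's box / torus / region members (`B3Ineq210ZeroBox`, `B3Ineq210ZeroTorus`,
`B3Ineq210RegularTorus`, `B3Ineq210RegularRegion`, …), not here.  (ii) `G_k(0)` and the pieces are KERNELS (real functions of two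
lattice points) obtained as limits along p03's centred cubes; the operator-product form `a_j²(L^jη)^{−4}G^η_jQ_j^*C^{(j)}Q_jG^η_j` of
the LATTICE pieces (products of infinite-lattice operators) is NOT constructed — only its box form (`B3Ineq210ZeroBox.piece_eq_ACB`)
and the limit; uniqueness of the limit among other exhaustions and `ℓ²`-operator statements are not claimed (as in
`B3GkZeroLattice`).  (iii) The derivative is the forward difference in the ROW variable; distances in the sup norm, lattice units
`× η` (Euclidean form with `δ₁/√(d+1)`).  (iv) Constants existential, depending on `d`, `L`, the window (print: O(1), δ₁ absolute).
(v) ROUTE: the print takes (2.10) for `G_k(0)` from [B4] («rescaling … and application of Propositions I.2.1 and I.2.3») exactly as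
for regions; here = p03 g4's kernel-proved box clauses (through [B4] (2.34)/(2.35)/(2.37) at `A = 0`) + the infinite-volume limit,
the Cauchy estimate being gen-6's nested-box (2.5) clause read at scale `j` — the same device as p03 g8's construction of `G_k(0)`.
Every input is a kernel theorem USED BY NAME; plain `def`s of real-valued kernels + one `ScaledKernels` instance and theorems only,
no Literature fact minted, no `sorry`; standard axioms.  Value = the tree now has the (2.6) pieces of the §3 propagator `G_k(0)`
with (2.10) — the input the estimates (3.13)/(3.14) p. 436 use on `ηℤ^d` —, NOT summit progress.
Unit `lit-balaban-p26` (Phase-2 proof seat p26, gen 34); HOME `run/shared/lean/pub/lit-balaban/` (rows B3.Eq2.10 / B3.Eq2.6 /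
B3.Txt@433, FILED.md, STATUS.md), 2026-08-22.
v1.1 (p26 gen 34, 2026-08-23; APPEND-ONLY §7, everything above byte-identical): the lattice Green identity of the SCALE-`j`
propagators — `fineOp_ctr_ctr` (the scale-`j` box operator at interior centred rows is `s_j²·latOpK (L^j) a_j (m²/s_j²)`),
`green_gscale` (box identity `fineOp_j·G_j = 1` read on the lattice), **`green_GscaleLat`** (`Σ_z H_j(x,z)𝒢_j(z,x′) = s_j^{−2}δ_{x,x′}`
on all of `ℤ^{d+1}`, `1 ≤ j ≤ k`; `j = k` is p03's `green_GkLat`), `GscaleLat_eq_sum_pieceLat` (partial sums of (2.6)) and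
**`abs_GscaleLat_le`** (`|𝒢_n(x,x′)| ≤ C·n·e^{−δ₁|x−x′|_∞/L^{n−1}}`, row summability) — asked for by p39 g17 for the scale
dictionary between `𝒢_j` and the rescaled `j`-th-step propagator in the assembly of (3.15)–(3.17) at a general external index.
-/

namespace Literature.MathematicalPhysics.QuantumFieldTheory.Balaban1983to89.B3Ineq210ZeroLattice

open Finset Matrix Filter Topology
open Literature.MathematicalPhysics.QuantumFieldTheory.Balaban1983to89.B4ContourShift (supNorm supNorm_nonneg
  abs_le_supNorm)
open Literature.MathematicalPhysics.QuantumFieldTheory.Balaban1983to89.B4Reflection242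
open Literature.MathematicalPhysics.QuantumFieldTheory.Balaban1983to89.B4BoxCov237
open Literature.MathematicalPhysics.QuantumFieldTheory.Balaban1983to89.B4TwoBox120
open Literature.MathematicalPhysics.QuantumFieldTheory.Balaban1983to89.B4Thm110ZeroBox
open Literature.MathematicalPhysics.QuantumFieldTheory.Balaban1983to89.B3DeltaGkZeroNest
open Literature.MathematicalPhysics.QuantumFieldTheory.Balaban1983to89.B3GkZeroLattice
open Literature.MathematicalPhysics.QuantumFieldTheory.Balaban1983to89.B3Ineq210ZeroBox (piece piece_zero piece_of_pos
  piece_of_le abs_piece_le abs_pieceDiff_le)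
open Literature.MathematicalPhysics.QuantumFieldTheory.Balaban1983to89.B3Sect2StatementsPart2 (ScaledKernels)

noncomputable section

variable {d : ℕ}

/-! ## §1 Scale bookkeeping: the nesting `C_t ⊂ C_{t+e}` read with `L^j`-blocks, coarse labels versus fine labels,
margin transfer from scale `k` to scale `j` -/

/-- kernel: integer division by `c ≥ 1` is `1`-Lipschitz: `|p/c − q/c| ≤ |p − q|`. [folklore] -/
private theorem abs_ediv_sub_ediv_le {c : ℤ} (hc : 0 < c) (p q : ℤ) : |p / c - q / c| ≤ |p - q| := by
  have key : ∀ p q : ℤ, p / c - q / c ≤ |p - q| := by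
    intro p q
    have h1 : p / c * c ≤ p := Int.ediv_mul_le p hc.ne'
    have h4 : q < (q / c + 1) * c := Int.lt_ediv_add_one_mul_self q hc
    by_contra hcon
    push Not at hcon
    -- `m := p/c − q/c ≥ |p − q| + 1 ≥ 1`, hence `p − q > c·(m − 1) ≥ m − 1 ≥ |p − q| ≥ p − q`: contradiction
    have hm : |p - q| + 1 ≤ p / c - q / c := by omega
    have hid : (p / c - q / c - 1) * c = p / c * c - (q / c + 1) * c := by ring
    have h5 : (p / c - q / c - 1) * c < p - q := by rw [hid]; linarith
    have h6 : 0 ≤ p / c - q / c - 1 := by have := abs_nonneg (p - q); omega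
    have h7 : (p / c - q / c - 1) * 1 ≤ (p / c - q / c - 1) * c := mul_le_mul_of_nonneg_left (by omega) h6
    have h8 := le_abs_self (p - q)
    rw [mul_one] at h7
    omega
  rw [abs_le]
  refine ⟨?_, key p q⟩
  have := key q p
  rw [abs_sub_comm] at this
  linarith

/-- kernel: COARSER BLOCK LABELS ARE CLOSER — `|blk c p − blk c q|_∞ ≤ |p − q|_∞` for `c ≥ 1`. [folklore] -/
private theorem supNorm_blk_sub_blk_le_supNorm {c : ℕ} (hc : 1 ≤ c) (p q : Fin (d + 1) → ℤ) :
    supNorm (blk c p - blk c q) ≤ supNorm (p - q) := by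
  refine supNorm_le_of_forall fun i => ?_
  have hc0 : (0 : ℤ) < c := by exact_mod_cast hc
  have h1 : |(blk c p - blk c q) i| ≤ |(p - q) i| := by
    simp only [blk, Pi.sub_apply]
    exact abs_ediv_sub_ediv_le hc0 (p i) (q i)
  exact le_trans (by exact_mod_cast h1) (abs_le_supNorm (p - q) i)

/-- kernel: `L^j · L^{k−j} = L^k` for `j ≤ k`. [folklore] -/
private theorem bj_mul_pow_sub {ℓ k j : ℕ} (hj : j ≤ k) : bj ℓ j * (ℓ + 1) ^ (k - j) = (ℓ + 1) ^ k := by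
  rw [bj, ← pow_add, Nat.add_sub_cancel' hj]

/-- kernel: `blk (L^k) = blk (L^{k−j}) ∘ blk (L^j)` for `j ≤ k`. [folklore] -/
private theorem blk_Lk_eq {ℓ k j : ℕ} (hj : j ≤ k) (x : Fin (d + 1) → ℤ) :
    blk ((ℓ + 1) ^ k) x = blk ((ℓ + 1) ^ (k - j)) (blk (bj ℓ j) x) := by
  rw [blk_blk, bj_mul_pow_sub hj]

/-- The scale-`j` shift of the nesting `C_t ⊂ C_{t+e}`: `L^{k−j}e` blocks of side `L^jη` in every direction (so that the
fine translation is `L^k e`, the same as the scale-`k` reading `B3GkZeroLattice.fits_cube`). [cite: Balaban1983Higgs3, (2.6) p.424] -/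
abbrev shiftJ (ℓ k j e : ℕ) : ℕ := (ℓ + 1) * ((ℓ + 1) ^ (k - j - 1) * e)

/-- kernel: `L^j · shiftJ = L^k · e` (`j + 1 ≤ k`). [folklore] -/
private theorem bj_mul_shiftJ {ℓ k j : ℕ} (hj : j + 1 ≤ k) (e : ℕ) : bj ℓ j * shiftJ ℓ k j e = (ℓ + 1) ^ k * e := by
  rw [shiftJ, bj, ← mul_assoc, ← mul_assoc, ← pow_succ, ← pow_add, show j + 1 + (k - j - 1) = k by omega]

/-- The nesting `C_t ⊂ C_{t+e}` READ AT SCALE `j`: the scale-`j` boxes `□^{(j)}(C_t) = Π[0, L^{k−j}(2t+1))` fit into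
`□^{(j)}(C_{t+e})` with the offset `shiftJ = L^{k−j}e`. [cite: Balaban1983Higgs3, (2.6) p.424] -/
theorem fits_cubeJ (ℓ k j t e : ℕ) :
    Fits (Mj ℓ k (cubeM (d := d) t) j) (Mj ℓ k (cubeM (t + e)) j) (fun _ => ((shiftJ ℓ k j e : ℕ) : ℤ)) := by
  intro i
  refine ⟨by positivity, ?_⟩
  simp only [Mj, Mp, cubeM, shiftJ]
  push_cast
  have hP : (0 : ℤ) ≤ ((ℓ : ℤ) + 1) * (((ℓ : ℤ) + 1) ^ (k - j - 1) * (e : ℤ)) := by positivity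
  have hid : ((ℓ : ℤ) + 1) * (((ℓ : ℤ) + 1) ^ (k - j - 1) * (2 * ((t : ℤ) + e) + 1))
      = ((ℓ : ℤ) + 1) * (((ℓ : ℤ) + 1) ^ (k - j - 1) * e) + ((ℓ : ℤ) + 1) * (((ℓ : ℤ) + 1) ^ (k - j - 1) * (2 * t + 1))
        + ((ℓ : ℤ) + 1) * (((ℓ : ℤ) + 1) ^ (k - j - 1) * e) := by ring
  linarith

section Transfer

variable {ℓ k j : ℕ}

/-- kernel: the fine box of `C_t` at scale `k` IS the fine box of `□^{(j)}(C_t)` refined by `L^j`-blocks (same side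
function). [folklore] -/
private theorem Nf_cube_eq (hj : j + 1 ≤ k) (t : ℕ) :
    (fun i => bj ℓ j * Mj ℓ k (cubeM (d := d) t) j i) = Nf ℓ k (cubeM t) := Nf_eq_bj_Mj hj _

/-- kernel: the fine translation of the scale-`j` nesting is the fine translation `L^k e` of the scale-`k` nesting. [folklore] -/
private theorem fine_shiftJ_eq (hj : j + 1 ≤ k) (e : ℕ) :
    (fun _ : Fin (d + 1) => ((bj ℓ j : ℕ) : ℤ) * (((shiftJ ℓ k j e : ℕ) : ℤ)))
      = fun _ => ((((ℓ + 1) ^ k : ℕ)) : ℤ) * (e : ℤ) := by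
  funext i
  have h := bj_mul_shiftJ (ℓ := ℓ) hj e
  exact_mod_cast congrArg (fun n : ℕ => (n : ℤ)) h

/-- **MARGIN TRANSFER.**  A scale-`k` label margin `r` of a fine point `X ∈ C_t` with respect to `C_t ⊂ C_{t+e}`
(`B3DeltaGkZeroNest.Margin (L^k) (fits_cube t e) r X`) is also a scale-`j` label margin `r` of the same point with respect to
the same nesting read with `L^j`-blocks (`Margin (L^j) (fits_cubeJ …) r X`): unit-block labels at sup-distance `≥ r + 1` have
`L^jη`-block labels at sup-distance `≥ r + 1` (coarser labels are closer). [cite: Balaban1983Higgs3, (2.6) p.424] -/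
theorem marginJ_of_margin (hj : j + 1 ≤ k) {t e r : ℕ} (X : ↥(boxDom (Nf ℓ k (cubeM (d := d) t))))
    (hX : Margin ((ℓ + 1) ^ k) (fits_cube (d := d) t e) r X) :
    Margin (bj ℓ j) (fits_cubeJ (d := d) ℓ k j t e) r ((ej ℓ k (cubeM t) j hj).symm X) := by
  intro y hy
  -- the outer scale-`j` fine point `y` is an outer scale-`k` fine point
  have hy2 : y.1 ∈ boxDom (fun i => (ℓ + 1) ^ k * cubeM (d := d) (t + e) i) :=
    mem_boxDom_of_eq (Nf_cube_eq (ℓ := ℓ) hj (t + e)) y.2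
  have hy3 : (y.1 - fun _ => ((((ℓ + 1) ^ k : ℕ)) : ℤ) * (e : ℤ)) ∉ boxDom (fun i => (ℓ + 1) ^ k * cubeM (d := d) t i) := by
    intro hmem
    apply hy
    rw [fine_shiftJ_eq hj e]
    exact mem_boxDom_of_eq (Nf_cube_eq (ℓ := ℓ) hj t).symm hmem
  have h1 := hX ⟨y.1, hy2⟩ hy3
  -- both embedded points have the same coordinates `X + L^k e`
  have hE : (emb ((fits_cubeJ (d := d) ℓ k j t e).scale (bj ℓ j)) ((ej ℓ k (cubeM t) j hj).symm X)).1
      = (emb ((fits_cube (d := d) t e).scale ((ℓ + 1) ^ k)) X).1 := by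
    rw [emb_val, emb_val, fine_shiftJ_eq hj e]
    rfl
  rw [hE]
  refine le_trans h1 ?_
  rw [blk_Lk_eq (show j ≤ k by omega), blk_Lk_eq (ℓ := ℓ) (show j ≤ k by omega) y.1]
  exact supNorm_blk_sub_blk_le_supNorm (Nat.one_le_pow _ _ (by omega)) _ _

end Transfer

/-! ## §2 The scale propagators `𝒢_j = G^η_j(C_t, 0)` (`1 ≤ j ≤ k`) of the centred cubes read on `ℤ^{d+1}`, their Cauchy
estimate (= gen-6's (2.5) value clause AT SCALE `j`) and the infinite-volume limits `𝒢_j(ηℤ^{d+1})` -/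

/-- **`g^{(j)}_t(x,x′) = G^η_j(C_t, 0; x, x′)`**: the scale-`j` zero-field propagator `𝒢_j = (−Δ^{η,N}_{C_t} + m² +
a_j(L^jη)^{−2}P_j)^{−1}` of [B4] (2.34) (`B4Thm110ZeroBox.Gfine ℓ k (cubeM t) j`, matrix units, `η = L^{−k}`) of the centred
cube `C_t` of `2t+1` unit blocks per direction, read at two points of `ℤ^{d+1}` (`0` when one of them is not in `C_t`); at
`j = k` this is `B3GkZeroLattice.gcube` (`gscale_top`). [cite: Balaban1983Higgs3, (2.6) p.424] -/
def gscale (ℓ k j t : ℕ) (a m2 : ℝ) (x x' : Fin (d + 1) → ℤ) : ℝ :=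
  if h : ctr ((ℓ + 1) ^ k) t x ∈ boxDom (Nf ℓ k (cubeM t)) ∧ ctr ((ℓ + 1) ^ k) t x' ∈ boxDom (Nf ℓ k (cubeM t)) then
    Gfine ℓ k (cubeM t) j a m2 ⟨_, h.1⟩ ⟨_, h.2⟩ else 0

section Scale

variable {ℓ k j : ℕ} {a m2 : ℝ}

/-- the top scale `j = k` is p03's cube propagator `g_t = G_k(C_t,0)`. [cite: Balaban1983Higgs3, (2.6) p.424] -/
theorem gscale_top (t : ℕ) (x x' : Fin (d + 1) → ℤ) : gscale ℓ k k t a m2 x x' = gcube ℓ k t a m2 x x' := rfl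

/-- `g^{(j)}_t` at two points of `C_t` is the box propagator `𝒢_j`. [cite: Balaban1983Higgs3, (2.6) p.424] -/
theorem gscale_eq {t : ℕ} {x x' : Fin (d + 1) → ℤ} (hx : ctr ((ℓ + 1) ^ k) t x ∈ boxDom (Nf ℓ k (cubeM t)))
    (hx' : ctr ((ℓ + 1) ^ k) t x' ∈ boxDom (Nf ℓ k (cubeM t))) :
    gscale ℓ k j t a m2 x x' = Gfine ℓ k (cubeM t) j a m2 ⟨_, hx⟩ ⟨_, hx'⟩ := by
  rw [gscale, dif_pos ⟨hx, hx'⟩]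

/-- `g^{(j)}_t` vanishes off the cube. [cite: Balaban1983Higgs3, (2.6) p.424] -/
theorem gscale_eq_zero {t : ℕ} {x x' : Fin (d + 1) → ℤ}
    (h : ¬ (ctr ((ℓ + 1) ^ k) t x ∈ boxDom (Nf ℓ k (cubeM t)) ∧ ctr ((ℓ + 1) ^ k) t x' ∈ boxDom (Nf ℓ k (cubeM t)))) :
    gscale ℓ k j t a m2 x x' = 0 := by
  rw [gscale, dif_neg h]

/-- `g^{(j)}_t` is symmetric. [cite: Balaban1983Higgs3, (2.6) p.424] -/
theorem gscale_comm (t : ℕ) (x x' : Fin (d + 1) → ℤ) : gscale ℓ k j t a m2 x x' = gscale ℓ k j t a m2 x' x := by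
  by_cases h : ctr ((ℓ + 1) ^ k) t x ∈ boxDom (Nf ℓ k (cubeM t)) ∧ ctr ((ℓ + 1) ^ k) t x' ∈ boxDom (Nf ℓ k (cubeM t))
  · rw [gscale_eq h.1 h.2, gscale_eq h.2 h.1]
    exact (Gfine_isSymm ℓ k (cubeM t) j a m2).apply _ _
  · rw [gscale_eq_zero h, gscale_eq_zero (fun h' => h ⟨h'.2, h'.1⟩)]

/-- **THE SCALE-`j` PROPAGATOR IS A RESCALED TOP-SCALE PROPAGATOR** ([B4] (2.44) read at scale `j`, `B4Thm110ZeroBox.Gfine_apply`):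
`𝒢_j(□; x, x′) = s_j^{−2}·G_j(□^{(j)}, 0; x, x′)` with `s_j = L^{k−j}`, `□^{(j)}` the same box measured in `L^jη`-blocks
(`Mj`), mass `m²s_j^{−2}`, running constant `a_j`, `L^j` fine points per block — the top-scale (`k ↤ j`) object to which gen-6's
nested-box estimate applies. [cite: Balaban1983Higgs3, (2.6) p.424] -/
theorem Gfine_eq_top_scaleJ (hℓ : 1 ≤ ℓ) (hj1 : 1 ≤ j) (hj : j + 1 ≤ k) {M : Fin (d + 1) → ℕ} (hM : ∀ i, 1 ≤ M i)
    (ha : 0 < a) (hm : 0 ≤ m2) (X Y : ↥(boxDom (Nf ℓ k M))) :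
    Gfine ℓ k M j a m2 X Y
      = (sc ℓ k j ^ 2)⁻¹ * Gfine ℓ j (Mj ℓ k M j) j a (m2 / sc ℓ k j ^ 2)
          ((ej ℓ k M j hj).symm X) ((ej ℓ k M j hj).symm Y) := by
  rw [Gfine_apply hℓ hj1 hj hM ha hm]
  congr 1
  have hG : Gfine ℓ j (Mj ℓ k M j) j a (m2 / sc ℓ k j ^ 2)
      = (boxOpR ((ℓ + 1) ^ j) (B1.aSeq a ((ℓ : ℝ) + 1) j) (m2 / sc ℓ k j ^ 2) (Mj ℓ k M j))⁻¹ := by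
    unfold Gfine; rw [fineOp_top]
  rw [hG]

/-- kernel: `e^{−δ s/L^j} ≤ e^{−δ s/L^k}` for `j ≤ k`, `s, δ ≥ 0`. [folklore] -/
private theorem exp_bj_le_exp_Lk {ℓ k j : ℕ} (hj : j ≤ k) {δ s : ℝ} (hδ : 0 ≤ δ) (hs : 0 ≤ s) :
    Real.exp (-(δ * (s / ((((ℓ + 1) ^ j : ℕ)) : ℝ)))) ≤ Real.exp (-(δ * (s / ((((ℓ + 1) ^ k : ℕ)) : ℝ)))) := by
  apply Real.exp_le_exp.2
  have hb : (0 : ℝ) < ((((ℓ + 1) ^ j : ℕ)) : ℝ) := by positivity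
  have hbk : ((((ℓ + 1) ^ j : ℕ)) : ℝ) ≤ ((((ℓ + 1) ^ k : ℕ)) : ℝ) := by
    exact_mod_cast Nat.pow_le_pow_right (by omega) hj
  have h1 : s / ((((ℓ + 1) ^ k : ℕ)) : ℝ) ≤ s / ((((ℓ + 1) ^ j : ℕ)) : ℝ) := div_le_div_of_nonneg_left hs hb hbk
  nlinarith

/-- kernel: `(L^k)^{d+1}·s_j^{−2} = s_j^{d+1}s_j^{−2}·(L^j)^{d+1}`. [folklore] -/
private theorem Lk_pow_mul_inv_sc_sq {ℓ k j : ℕ} (hj : j ≤ k) :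
    ((((ℓ + 1) ^ k : ℕ)) : ℝ) ^ (d + 1) * (sc ℓ k j ^ 2)⁻¹
      = sc ℓ k j ^ (d + 1) * (sc ℓ k j ^ 2)⁻¹ * ((((ℓ + 1) ^ j : ℕ)) : ℝ) ^ (d + 1) := by
  have h := sc_mul_bj (ℓ := ℓ) hj
  rw [bj_cast] at h
  push_cast
  rw [← h, mul_pow]
  ring

/-- **THE CAUCHY ESTIMATE FOR THE SCALE-`j` PROPAGATORS** (`1 ≤ j ≤ k`).  For points of label radius `≤ R` and cubes
`C_t ⊂ C_{t+e}` with `t ≥ R + 3`: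
`η^{−(d+1)}|g^{(j)}_{t+e}(x,x′) − g^{(j)}_t(x,x′)| ≤ C·s_j^{d+1}s_j^{−2}·e^{−δ₀(t−R)}·e^{−δ₀η|x−x′|_∞}` uniformly in `e`, `k`, the
window — gen-6's value clause `B3DeltaGkZeroNest.abs_dGk_le` for the nested pair READ AT SCALE `j` (`Gfine_eq_top_scaleJ`, mass
`m²s_j^{−2} ≤ m²`, the scale-`k` label margin `t − R` of p03's `margin_ctr` transferred to scale `j` by `marginJ_of_margin`);
at `j = k` it is p03's `abs_gcube_sub_le`. [cite: Balaban1983Higgs3, (2.6) p.424] -/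
theorem abs_gscale_sub_le (d ℓ : ℕ) (hℓ : 1 ≤ ℓ) (amin aplus m2plus : ℝ) (ha : 0 < amin) :
    ∃ δ₀ C : ℝ, 0 < δ₀ ∧ 0 < C ∧ ∀ (k : ℕ), 1 ≤ k → ∀ (j : ℕ), 1 ≤ j → j ≤ k →
      ∀ (a m2 : ℝ), amin ≤ a → a ≤ aplus → 0 ≤ m2 → m2 ≤ m2plus →
      ∀ (R t e : ℕ), R + 3 ≤ t → ∀ (x x' : Fin (d + 1) → ℤ), LabRad ((ℓ + 1) ^ k) R x → LabRad ((ℓ + 1) ^ k) R x' →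
        ((((ℓ + 1) ^ k : ℕ)) : ℝ) ^ (d + 1) * |gscale ℓ k j (t + e) a m2 x x' - gscale ℓ k j t a m2 x x'|
          ≤ C * (sc ℓ k j ^ (d + 1) * (sc ℓ k j ^ 2)⁻¹) * Real.exp (-(δ₀ * ((t : ℝ) - R))) *
            Real.exp (-(δ₀ * (supNorm (x - x') / ((((ℓ + 1) ^ k : ℕ)) : ℝ)))) := by
  obtain ⟨δ₀, C, hδ₀, hC, h⟩ := abs_dGk_le d ℓ hℓ amin aplus m2plus ha
  refine ⟨δ₀, C, hδ₀, hC, ?_⟩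
  intro k hk j hj1 hjk a m2 h1 h2 h3 h4 R t e ht x x' hx hx'
  have hn : 1 ≤ (ℓ + 1) ^ k := Nat.one_le_pow _ _ (by omega)
  have hRt : R ≤ t := by omega
  have hxm := ctr_mem (d := d) hn hRt hx
  have hxm' := ctr_mem (d := d) hn hRt hx'
  have hxme := ctr_add_mem t e hxm
  have hxme' := ctr_add_mem t e hxm'
  have hmx := margin_ctr hn (show R + (t - R) ≤ t by omega) e hx hxm
  have hmx' := margin_ctr hn (show R + (t - R) ≤ t by omega) e hx' hxm'
  rw [gscale_eq hxme hxme', gscale_eq hxm hxm']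
  rcases Nat.lt_or_ge j k with hjk' | hkj
  · -- `1 ≤ j < k`: read the nesting at scale `j`
    have hj : j + 1 ≤ k := hjk'
    have ha0 : 0 < a := ha.trans_le h1
    have hs2 : 1 ≤ sc ℓ k j ^ 2 := one_le_pow₀ (one_le_sc ℓ k j)
    have hm' : 0 ≤ m2 / sc ℓ k j ^ 2 := div_nonneg h3 (by positivity)
    have hm'' : m2 / sc ℓ k j ^ 2 ≤ m2plus := (div_le_self h3 hs2).trans h4
    rw [Gfine_eq_top_scaleJ hℓ hj1 hj (cubeM_pos (t + e)) ha0 h3, Gfine_eq_top_scaleJ hℓ hj1 hj (cubeM_pos t) ha0 h3]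
    -- the embedded scale-`j` points of `C_t` are the scale-`j` points of `C_{t+e}`
    set X : ↥(boxDom (fun i => bj ℓ j * Mj ℓ k (cubeM (d := d) t) j i)) :=
      (ej ℓ k (cubeM t) j hj).symm ⟨ctr ((ℓ + 1) ^ k) t x, hxm⟩ with hXdef
    set X' : ↥(boxDom (fun i => bj ℓ j * Mj ℓ k (cubeM (d := d) t) j i)) :=
      (ej ℓ k (cubeM t) j hj).symm ⟨ctr ((ℓ + 1) ^ k) t x', hxm'⟩ with hX'def
    have hE : emb ((fits_cubeJ (d := d) ℓ k j t e).scale (bj ℓ j)) X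
        = (ej ℓ k (cubeM (t + e)) j hj).symm ⟨ctr ((ℓ + 1) ^ k) (t + e) x, hxme⟩ :=
      Subtype.ext (by rw [emb_val, fine_shiftJ_eq hj e, hXdef]; exact (ctr_add _ t e x).symm)
    have hE' : emb ((fits_cubeJ (d := d) ℓ k j t e).scale (bj ℓ j)) X'
        = (ej ℓ k (cubeM (t + e)) j hj).symm ⟨ctr ((ℓ + 1) ^ k) (t + e) x', hxme'⟩ :=
      Subtype.ext (by rw [emb_val, fine_shiftJ_eq hj e, hX'def]; exact (ctr_add _ t e x').symm)
    have hb := h j hj1 a (m2 / sc ℓ k j ^ 2) h1 h2 hm' hm'' (Mj ℓ k (cubeM t) j) (Mj ℓ k (cubeM (t + e)) j) _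
      (fits_cubeJ ℓ k j t e) (Mj_pos (cubeM_pos t)) (t - R) (by omega) X X'
      (marginJ_of_margin hj _ hmx) (marginJ_of_margin hj _ hmx')
    rw [dGk, hE, hE'] at hb
    have hXX : supNorm (X.1 - X'.1) = supNorm (x - x') := by
      rw [hXdef, hX'def]
      show supNorm (ctr ((ℓ + 1) ^ k) t x - ctr ((ℓ + 1) ^ k) t x') = _
      rw [ctr_sub_ctr]
    rw [hXX, Nat.cast_sub hRt] at hb
    have hq : 0 ≤ sc ℓ k j ^ (d + 1) * (sc ℓ k j ^ 2)⁻¹ := by have := sc_pos ℓ k j; positivity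
    rw [← mul_sub, abs_mul, abs_of_nonneg (by positivity : (0 : ℝ) ≤ (sc ℓ k j ^ 2)⁻¹), ← mul_assoc,
      Lk_pow_mul_inv_sc_sq hjk, mul_assoc]
    calc sc ℓ k j ^ (d + 1) * (sc ℓ k j ^ 2)⁻¹ * (((((ℓ + 1) ^ j : ℕ)) : ℝ) ^ (d + 1) * |_|)
        ≤ sc ℓ k j ^ (d + 1) * (sc ℓ k j ^ 2)⁻¹ * (C * Real.exp (-(δ₀ * ((t : ℝ) - R))) *
            Real.exp (-(δ₀ * (supNorm (x - x') / (((ℓ + 1) ^ j : ℕ) : ℝ))))) :=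
          mul_le_mul_of_nonneg_left hb hq
      _ ≤ sc ℓ k j ^ (d + 1) * (sc ℓ k j ^ 2)⁻¹ * (C * Real.exp (-(δ₀ * ((t : ℝ) - R))) *
            Real.exp (-(δ₀ * (supNorm (x - x') / (((ℓ + 1) ^ k : ℕ) : ℝ))))) :=
          mul_le_mul_of_nonneg_left (mul_le_mul_of_nonneg_left
            (exp_bj_le_exp_Lk hjk hδ₀.le (supNorm_nonneg _)) (by positivity)) hq
      _ = _ := by ring
  · -- `j = k`: p03's nesting at scale `k`
    have hjk0 : j = k := le_antisymm hjk hkj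
    subst hjk0
    have hb := h j hk a m2 h1 h2 h3 h4 (cubeM t) (cubeM (t + e)) _ (fits_cube t e) (cubeM_pos t) (t - R) (by omega)
      ⟨_, hxm⟩ ⟨_, hxm'⟩ hmx hmx'
    rw [dGk, emb_ctr t e hxm hxme, emb_ctr t e hxm' hxme', Nat.cast_sub hRt] at hb
    simp only [ctr_sub_ctr] at hb
    rw [sc_self, one_pow, one_pow, inv_one, mul_one, mul_one]
    exact hb

/-- **`𝒢_j(ηℤ^{d+1})(x,x′)`, THE INFINITE-VOLUME SCALE-`j` PROPAGATOR** (`1 ≤ j ≤ k`, matrix units; physical kernel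
`η^{−(d+1)}·GscaleLat`): the limit of `g^{(j)}_t(x,x′)` as the cubes `C_t` exhaust the lattice (`tendsto_gscale`); at `j = k` it
is p03's `G_k(0) = B3GkZeroLattice.GkLat` (`GscaleLat_top`). [cite: Balaban1983Higgs3, (2.6) p.424] -/
def GscaleLat (ℓ k j : ℕ) (a m2 : ℝ) (x x' : Fin (d + 1) → ℤ) : ℝ :=
  limUnder atTop fun t => gscale ℓ k j t a m2 x x'

/-- the top scale is `G_k(0)`. [cite: Balaban1983Higgs3, p.433 («we substitute G_k(□,0) = G_k(0) + δG_k(□,ηZ^d,0)»)] -/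
theorem GscaleLat_top (x x' : Fin (d + 1) → ℤ) : GscaleLat ℓ k k a m2 x x' = GkLat ℓ k a m2 x x' := rfl

/-- kernel: `e^{−c(m+3)} = e^{−3c}·(e^{−c})^m`. [folklore] -/
private theorem exp_neg_mul_add_three (c : ℝ) (m : ℕ) :
    Real.exp (-(c * ((m : ℝ) + 3))) = Real.exp (-(c * 3)) * Real.exp (-c) ^ m := by
  rw [← Real.exp_nat_mul, ← Real.exp_add]; ring_nf

/-- **EXISTENCE OF THE INFINITE-VOLUME LIMITS.**  For `1 ≤ j ≤ k`, `a > 0`, `m² ≥ 0` and every pair of lattice points the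
scale-`j` cube propagators `g^{(j)}_t(x,x′)` converge as `t → ∞` (to `GscaleLat`): geometrically Cauchy by `abs_gscale_sub_le`.
[cite: Balaban1983Higgs3, (2.6) p.424] -/
theorem tendsto_gscale {ℓ k j : ℕ} (hℓ : 1 ≤ ℓ) (hk : 1 ≤ k) (hj1 : 1 ≤ j) (hjk : j ≤ k) {a m2 : ℝ} (ha : 0 < a)
    (hm : 0 ≤ m2) (x x' : Fin (d + 1) → ℤ) :
    Tendsto (fun t => gscale ℓ k j t a m2 x x') atTop (𝓝 (GscaleLat ℓ k j a m2 x x')) := by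
  obtain ⟨R, hx, hx'⟩ := exists_labRad₂ ((ℓ + 1) ^ k) x x'
  obtain ⟨δ₀, C, hδ₀, hC, h⟩ := abs_gscale_sub_le d ℓ hℓ a a m2 ha
  set Q : ℝ := sc ℓ k j ^ (d + 1) * (sc ℓ k j ^ 2)⁻¹ with hQ
  have hQ0 : 0 ≤ Q := by have := sc_pos ℓ k j; positivity
  set u : ℕ → ℝ := fun m => gscale ℓ k j (m + (R + 3)) a m2 x x' with hu
  have hL : (1 : ℝ) ≤ ((((ℓ + 1) ^ k : ℕ)) : ℝ) ^ (d + 1) := one_le_pow₀ (by exact_mod_cast Nat.one_le_pow _ _ (by omega))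
  have hstep : ∀ m, dist (u m) (u (m + 1)) ≤ C * Q * Real.exp (-(δ₀ * 3)) * Real.exp (-δ₀) ^ m := by
    intro m
    have hb := h k hk j hj1 hjk a m2 le_rfl le_rfl hm le_rfl R (m + (R + 3)) 1 (by omega) x x' hx hx'
    rw [show m + (R + 3) + 1 = m + 1 + (R + 3) by ring] at hb
    have hE : Real.exp (-(δ₀ * (supNorm (x - x') / ((((ℓ + 1) ^ k : ℕ)) : ℝ)))) ≤ 1 :=
      Real.exp_le_one_iff.2 (by
        have := div_nonneg (supNorm_nonneg (x - x')) (Nat.cast_nonneg ((ℓ + 1) ^ k)); nlinarith)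
    have hT : Real.exp (-(δ₀ * (((m + (R + 3) : ℕ) : ℝ) - R))) = Real.exp (-(δ₀ * 3)) * Real.exp (-δ₀) ^ m := by
      rw [← exp_neg_mul_add_three]; congr 1; push_cast; ring
    rw [dist_comm, Real.dist_eq]
    calc |u (m + 1) - u m| ≤ ((((ℓ + 1) ^ k : ℕ)) : ℝ) ^ (d + 1) * |u (m + 1) - u m| :=
          le_mul_of_one_le_left (abs_nonneg _) hL
      _ ≤ C * Q * Real.exp (-(δ₀ * (((m + (R + 3) : ℕ) : ℝ) - R))) *
            Real.exp (-(δ₀ * (supNorm (x - x') / ((((ℓ + 1) ^ k : ℕ)) : ℝ)))) := hb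
      _ ≤ C * Q * Real.exp (-(δ₀ * (((m + (R + 3) : ℕ) : ℝ) - R))) * 1 :=
          mul_le_mul_of_nonneg_left hE (by positivity)
      _ = C * Q * Real.exp (-(δ₀ * 3)) * Real.exp (-δ₀) ^ m := by rw [mul_one, hT]; ring
  have hcs : CauchySeq u :=
    cauchySeq_of_le_geometric (Real.exp (-δ₀)) (C * Q * Real.exp (-(δ₀ * 3))) (Real.exp_lt_one_iff.2 (by linarith)) hstep
  obtain ⟨G, hG⟩ := cauchySeq_tendsto_of_complete hcs
  exact tendsto_nhds_limUnder ⟨G, (tendsto_add_atTop_iff_nat (f := fun t => gscale ℓ k j t a m2 x x') (R + 3)).1 hG⟩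

/-- kernel: a bound valid along a convergent sequence passes to the limit (with a fixed non-negative weight and a fixed
comparison term). [folklore] -/
private theorem mul_abs_sub_le_of_tendsto {f : ℕ → ℝ} {A c g B : ℝ} (hf : Tendsto f atTop (𝓝 A)) (T : ℕ)
    (hB : ∀ t, T ≤ t → c * |f t - g| ≤ B) : c * |A - g| ≤ B :=
  le_of_tendsto ((hf.sub_const g).abs.const_mul c) (eventually_atTop.2 ⟨T, hB⟩)

/-- **RATE OF CONVERGENCE**: `η^{−(d+1)}|𝒢_j(ηℤ^{d+1})(x,x′) − g^{(j)}_t(x,x′)| ≤ C·s_j^{d+1}s_j^{−2}·e^{−δ₀(t−R)}·e^{−δ₀η|x−x′|_∞}`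
for points of label radius `≤ R` and `t ≥ R + 3`, uniformly in `1 ≤ j ≤ k` and the window. [cite: Balaban1983Higgs3, (2.6) p.424] -/
theorem abs_GscaleLat_sub_gscale_le (d ℓ : ℕ) (hℓ : 1 ≤ ℓ) (amin aplus m2plus : ℝ) (ha : 0 < amin) :
    ∃ δ₀ C : ℝ, 0 < δ₀ ∧ 0 < C ∧ ∀ (k : ℕ), 1 ≤ k → ∀ (j : ℕ), 1 ≤ j → j ≤ k →
      ∀ (a m2 : ℝ), amin ≤ a → a ≤ aplus → 0 ≤ m2 → m2 ≤ m2plus →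
      ∀ (R t : ℕ), R + 3 ≤ t → ∀ (x x' : Fin (d + 1) → ℤ), LabRad ((ℓ + 1) ^ k) R x → LabRad ((ℓ + 1) ^ k) R x' →
        ((((ℓ + 1) ^ k : ℕ)) : ℝ) ^ (d + 1) * |GscaleLat ℓ k j a m2 x x' - gscale ℓ k j t a m2 x x'|
          ≤ C * (sc ℓ k j ^ (d + 1) * (sc ℓ k j ^ 2)⁻¹) * Real.exp (-(δ₀ * ((t : ℝ) - R))) *
            Real.exp (-(δ₀ * (supNorm (x - x') / ((((ℓ + 1) ^ k : ℕ)) : ℝ)))) := by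
  obtain ⟨δ₀, C, hδ₀, hC, h⟩ := abs_gscale_sub_le d ℓ hℓ amin aplus m2plus ha
  refine ⟨δ₀, C, hδ₀, hC, ?_⟩
  intro k hk j hj1 hjk a m2 h1 h2 h3 h4 R t ht x x' hx hx'
  have hconv : Tendsto (fun e => gscale ℓ k j (e + t) a m2 x x') atTop (𝓝 (GscaleLat ℓ k j a m2 x x')) :=
    (tendsto_add_atTop_iff_nat (f := fun t' => gscale ℓ k j t' a m2 x x') t).2
      (tendsto_gscale hℓ hk hj1 hjk (ha.trans_le h1) h3 x x')
  refine mul_abs_sub_le_of_tendsto hconv 0 fun e _ => ?_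
  rw [add_comm e t]
  exact h k hk j hj1 hjk a m2 h1 h2 h3 h4 R t e ht x x' hx hx'

/-- `𝒢_j(ηℤ^{d+1})` is a symmetric kernel. [cite: Balaban1983Higgs3, (2.6) p.424] -/
theorem GscaleLat_comm (x x' : Fin (d + 1) → ℤ) : GscaleLat ℓ k j a m2 x x' = GscaleLat ℓ k j a m2 x' x := by
  unfold GscaleLat
  congr 1
  funext t
  exact gscale_comm t x x'

end Scale

/-! ## §3 The lattice pieces `G^η_{(j)}(0)` of (2.6) for `G_k(0) = G_k(ηℤ^{d+1}, 0)`, as limits of the box pieces, and the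
identity (2.6) itself -/

/-- **The scale pieces `G^η_{(j)}(0)` of (2.6) FOR THE INFINITE-VOLUME ZERO-FIELD PROPAGATOR `G_k(0)`** (matrix units, `η = L^{−k}`,
`L = ℓ + 1`): `G^η_{(0)}(0) = 𝒢_1(ηℤ^{d+1})`, `G^η_{(j)}(0) = 𝒢_{j+1}(ηℤ^{d+1}) − 𝒢_j(ηℤ^{d+1})` for `1 ≤ j ≤ k − 1`, and `0` for
`j ≥ k` — the limits of p03 g4's box pieces `B3Ineq210ZeroBox.piece` along the centred cubes (`tendsto_pieceCube`); p. 434: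
*"We apply the decomposition (2.6) to the propagators G_k(0), G_k"*. [cite: Balaban1983Higgs3, (2.6) p.424] -/
def pieceLat (ℓ k j : ℕ) (a m2 : ℝ) (x x' : Fin (d + 1) → ℤ) : ℝ :=
  if j = 0 then GscaleLat ℓ k 1 a m2 x x'
  else if j + 1 ≤ k then GscaleLat ℓ k (j + 1) a m2 x x' - GscaleLat ℓ k j a m2 x x' else 0

/-- **The box pieces of `C_t` read on `ℤ^{d+1}`**: `B3Ineq210ZeroBox.piece ℓ k (cubeM t) j` at the centred points (`0` off the
cube). [cite: Balaban1983Higgs3, (2.6) p.424] -/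
def pieceCube (ℓ k j t : ℕ) (a m2 : ℝ) (x x' : Fin (d + 1) → ℤ) : ℝ :=
  if h : ctr ((ℓ + 1) ^ k) t x ∈ boxDom (Nf ℓ k (cubeM t)) ∧ ctr ((ℓ + 1) ^ k) t x' ∈ boxDom (Nf ℓ k (cubeM t)) then
    piece ℓ k (cubeM t) j a m2 ⟨_, h.1⟩ ⟨_, h.2⟩ else 0

section Pieces

variable {ℓ k j : ℕ} {a m2 : ℝ} {x x' : Fin (d + 1) → ℤ}

/-- `G^η_{(0)}(0) = 𝒢_1(ηℤ^{d+1})` (= `C^{(0),η}` of (2.6) on the infinite lattice). [cite: Balaban1983Higgs3, (2.6) p.424] -/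
theorem pieceLat_zero : pieceLat ℓ k 0 a m2 x x' = GscaleLat ℓ k 1 a m2 x x' := by
  simp [pieceLat]

/-- `G^η_{(j)}(0) = 𝒢_{j+1} − 𝒢_j` for `1 ≤ j ≤ k − 1`. [cite: Balaban1983Higgs3, (2.6) p.424] -/
theorem pieceLat_of_pos (hj1 : 1 ≤ j) (hj : j + 1 ≤ k) :
    pieceLat ℓ k j a m2 x x' = GscaleLat ℓ k (j + 1) a m2 x x' - GscaleLat ℓ k j a m2 x x' := by
  unfold pieceLat
  rw [if_neg (by omega), if_pos hj]

/-- no pieces beyond `j = k − 1`. [cite: Balaban1983Higgs3, (2.6) p.424] -/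
theorem pieceLat_of_le (hj1 : 1 ≤ j) (hkj : k ≤ j) : pieceLat ℓ k j a m2 x x' = 0 := by
  unfold pieceLat
  rw [if_neg (by omega), if_neg (by omega)]

/-- the lattice pieces are symmetric kernels. [cite: Balaban1983Higgs3, (2.6) p.424] -/
theorem pieceLat_comm (x x' : Fin (d + 1) → ℤ) : pieceLat ℓ k j a m2 x x' = pieceLat ℓ k j a m2 x' x := by
  unfold pieceLat
  rw [GscaleLat_comm (j := 1) x x', GscaleLat_comm (j := j + 1) x x', GscaleLat_comm (j := j) x x']

/-- the box pieces at the centred points, written with the scale propagators `g^{(j)}_t`. [cite: Balaban1983Higgs3, (2.6) p.424] -/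
theorem pieceCube_eq_gscale (t : ℕ) (x x' : Fin (d + 1) → ℤ) :
    pieceCube ℓ k j t a m2 x x'
      = if j = 0 then gscale ℓ k 1 t a m2 x x'
        else if j + 1 ≤ k then gscale ℓ k (j + 1) t a m2 x x' - gscale ℓ k j t a m2 x x' else 0 := by
  by_cases h : ctr ((ℓ + 1) ^ k) t x ∈ boxDom (Nf ℓ k (cubeM t)) ∧ ctr ((ℓ + 1) ^ k) t x' ∈ boxDom (Nf ℓ k (cubeM t))
  · simp only [pieceCube, gscale, dif_pos h]
    unfold piece
    split_ifs <;> simp [Matrix.sub_apply]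
  · simp only [pieceCube, gscale, dif_neg h]
    split_ifs <;> simp

/-- **THE LATTICE PIECES ARE THE LIMITS OF THE BOX PIECES** along the centred cubes (`k ≥ 1`, `a > 0`, `m² ≥ 0`, every `j`).
[cite: Balaban1983Higgs3, (2.6) p.424] -/
theorem tendsto_pieceCube (hℓ : 1 ≤ ℓ) (hk : 1 ≤ k) (ha : 0 < a) (hm : 0 ≤ m2) (j : ℕ) (x x' : Fin (d + 1) → ℤ) :
    Tendsto (fun t => pieceCube ℓ k j t a m2 x x') atTop (𝓝 (pieceLat ℓ k j a m2 x x')) := by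
  simp only [pieceCube_eq_gscale]
  rcases Nat.eq_zero_or_pos j with hj0 | hj1
  · subst hj0
    simp only [pieceLat, if_true]
    exact tendsto_gscale hℓ hk le_rfl hk ha hm x x'
  · by_cases hj : j + 1 ≤ k
    · simp only [pieceLat, if_neg (Nat.pos_iff_ne_zero.1 hj1), if_pos hj]
      exact (tendsto_gscale hℓ hk (by omega) hj ha hm x x').sub (tendsto_gscale hℓ hk hj1 (by omega) ha hm x x')
    · simp only [pieceLat, if_neg (Nat.pos_iff_ne_zero.1 hj1), if_neg hj]
      exact tendsto_const_nhds

/-- **(2.6) FOR `G_k(0)`**: `Σ_{j=0}^{k−1} G^η_{(j)}(0) = G_k(0)` on `ηℤ^{d+1} × ηℤ^{d+1}` (`G_k(0) = B3GkZeroLattice.GkLat`; telescoping,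
the top scale propagator being `G_k(0)` itself) — p. 424 (2.6) *"G_k(Ω, B̃) = C^{(0),η}(Ω, B̃) + Σ_{j=1}^{k−1} a_j²(L^jη)^{−4}G^η_j(Ω, B̃)
Q_j^*(B̃)C^{(j),L^jη}(Ω, B̃)Q_j(B̃)G^η_j(Ω, B̃) = Σ_{j=0}^{k−1} G^η_{(j)}(Ω, B̃)"* applied, as on p. 434, to `G_k(0)`.
[cite: Balaban1983Higgs3, (2.6) p.424] -/
theorem sum_pieceLat (hk : 1 ≤ k) (x x' : Fin (d + 1) → ℤ) :
    ∑ j ∈ Finset.range k, pieceLat ℓ k j a m2 x x' = GkLat ℓ k a m2 x x' := by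
  have main : ∀ n, 1 ≤ n → n ≤ k → ∑ j ∈ Finset.range n, pieceLat ℓ k j a m2 x x' = GscaleLat ℓ k n a m2 x x' := by
    intro n hn
    induction n, hn using Nat.le_induction with
    | base =>
      intro _
      rw [Finset.sum_range_one, pieceLat_zero]
    | succ n hn ih =>
      intro hnk
      rw [Finset.sum_range_succ, ih (by omega), pieceLat_of_pos hn hnk, add_sub_cancel]
  rw [main k hk le_rfl, GscaleLat_top]

/-- (2.6) together with the lattice Green identity of `G_k(0)` (p03's `B3GkZeroLattice.green_GkLat`): the sum of the pieces
inverts `−Δ^η + m² + a_kQ_k^*Q_k` on the whole lattice, `Σ_z H(x,z)·Σ_{j<k} G^η_{(j)}(0)(z,x′) = δ_{x,x′}`.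
[cite: Balaban1983Higgs3, (2.6) p.424] -/
theorem green_sum_pieceLat (hℓ : 1 ≤ ℓ) (hk : 1 ≤ k) (ha : 0 < a) (hm : 0 ≤ m2) (x x' : Fin (d + 1) → ℤ) :
    ∑ z ∈ opSupp ((ℓ + 1) ^ k) x,
        latOpK ((ℓ + 1) ^ k) (B1.aSeq a ((ℓ : ℝ) + 1) k) m2 x z * ∑ j ∈ Finset.range k, pieceLat ℓ k j a m2 z x'
      = if x = x' then 1 else 0 := by
  simp only [sum_pieceLat hk]
  exact green_GkLat hℓ hk ha hm x x'

end Pieces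

/-! ## §4 (2.10) for the lattice pieces: the value and derivative clauses of `B3Ineq210ZeroBox` passed to the limit
(their constants do not see the box) -/

/-- kernel: centring commutes with a lattice translation. [folklore] -/
private theorem ctr_add_vec (n t : ℕ) (x v : Fin (d + 1) → ℤ) : ctr n t (x + v) = ctr n t x + v := by
  funext i; simp only [ctr_apply, Pi.add_apply]; ring

/-- **(2.10), VALUE CLAUSE, for the lattice pieces** (counting normalisation; `η^{-1} = L^k`): there are `δ₁ > 0`, `C > 0`
(on `d`, `L`, the window only) with `|G^η_{(j)}(0)(x,x′)| ≤ C·L^{−j(d+1)}·(L^jη)²·e^{−δ₁|x−x′|_∞/L^j}` for every `k ≥ 1`, `j < k`,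
window point and ALL `x, x′ ∈ ℤ^{d+1}` — p03 g4's box clause `B3Ineq210ZeroBox.abs_piece_le` (uniform in the box) in the limit
along the centred cubes; the printed `|G^η_{(j)}(Ω, B̃; x, x′)| ≤ O(1)(L^jη)^{−d+2}e^{−δ₁(L^jη)^{−1}|x−x′|}` times `η^{d+1}` for
`Ω = ηℤ^{d+1}`, `B̃ = 0`. [cite: Balaban1983Higgs3, (2.10) p.426] -/
theorem abs_pieceLat_le (d ℓ : ℕ) (hℓ : 1 ≤ ℓ) (amin aplus m2plus : ℝ) (ha : 0 < amin) :
    ∃ δ₁ C : ℝ, 0 < δ₁ ∧ 0 < C ∧ ∀ (k : ℕ), 1 ≤ k → ∀ (j : ℕ), j < k → ∀ (a m2 : ℝ), amin ≤ a → a ≤ aplus →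
      0 ≤ m2 → m2 ≤ m2plus → ∀ (x x' : Fin (d + 1) → ℤ),
        |pieceLat ℓ k j a m2 x x'|
          ≤ C * ((((bj ℓ j : ℕ) : ℝ) ^ (d + 1))⁻¹ * (sc ℓ k j ^ 2)⁻¹)
            * Real.exp (-(δ₁ * supNorm (x - x') / ((bj ℓ j : ℕ) : ℝ))) := by
  obtain ⟨δ₁, C, hδ₁, hC, h⟩ := abs_piece_le d ℓ hℓ amin aplus m2plus ha
  refine ⟨δ₁, C, hδ₁, hC, ?_⟩
  intro k hk j hjk a m2 h1 h2 h3 h4 x x'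
  obtain ⟨R, hx, hx'⟩ := exists_labRad₂ ((ℓ + 1) ^ k) x x'
  have hn : 1 ≤ (ℓ + 1) ^ k := Nat.one_le_pow _ _ (by omega)
  have hconv := (tendsto_pieceCube hℓ hk (ha.trans_le h1) h3 j x x').abs
  refine le_of_tendsto hconv (eventually_atTop.2 ⟨R, fun t ht => ?_⟩)
  have hxm := ctr_mem (d := d) hn ht hx
  have hxm' := ctr_mem (d := d) hn ht hx'
  have hb := h k hk j hjk a m2 h1 h2 h3 h4 (cubeM t) (cubeM_pos t) ⟨_, hxm⟩ ⟨_, hxm'⟩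
  rw [ctr_sub_ctr] at hb
  simpa only [pieceCube, dif_pos (And.intro hxm hxm')] using hb

/-- **(2.10), DERIVATIVE CLAUSE, for the lattice pieces** («an additional factor (L^jη)^{−1}»; counting normalisation):
`L^k·|G^η_{(j)}(0)(x+e_μ,x′) − G^η_{(j)}(0)(x,x′)| ≤ C·L^{−j(d+1)}·(L^jη)·e^{−δ₁|x−x′|_∞/L^j}` for every `k ≥ 1`, `j < k`, window
point, axis `μ` and ALL `x, x′ ∈ ℤ^{d+1}` (no boundary: every bond `⟨x, x+ηe_μ⟩` is a bond of the lattice) — p03 g4's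
`B3Ineq210ZeroBox.abs_pieceDiff_le` in the limit. [cite: Balaban1983Higgs3, (2.10) p.426] -/
theorem abs_pieceLatDiff_le (d ℓ : ℕ) (hℓ : 1 ≤ ℓ) (amin aplus m2plus : ℝ) (ha : 0 < amin) :
    ∃ δ₁ C : ℝ, 0 < δ₁ ∧ 0 < C ∧ ∀ (k : ℕ), 1 ≤ k → ∀ (j : ℕ), j < k → ∀ (a m2 : ℝ), amin ≤ a → a ≤ aplus →
      0 ≤ m2 → m2 ≤ m2plus → ∀ (μ : Fin (d + 1)) (x x' : Fin (d + 1) → ℤ),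
        ((((ℓ + 1) ^ k : ℕ)) : ℝ) * |pieceLat ℓ k j a m2 (x + Pi.single μ 1) x' - pieceLat ℓ k j a m2 x x'|
          ≤ C * ((((bj ℓ j : ℕ) : ℝ) ^ (d + 1))⁻¹ * (sc ℓ k j)⁻¹)
            * Real.exp (-(δ₁ * supNorm (x - x') / ((bj ℓ j : ℕ) : ℝ))) := by
  obtain ⟨δ₁, C, hδ₁, hC, h⟩ := abs_pieceDiff_le d ℓ hℓ amin aplus m2plus ha
  refine ⟨δ₁, C, hδ₁, hC, ?_⟩
  intro k hk j hjk a m2 h1 h2 h3 h4 μ x x'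
  obtain ⟨R₁, hx, hx'⟩ := exists_labRad₂ ((ℓ + 1) ^ k) x x'
  obtain ⟨R₂, hxe, -⟩ := exists_labRad₂ ((ℓ + 1) ^ k) (x + Pi.single μ 1) x
  have hn : 1 ≤ (ℓ + 1) ^ k := Nat.one_le_pow _ _ (by omega)
  have ha0 : 0 < a := ha.trans_le h1
  have hconv := (((tendsto_pieceCube hℓ hk ha0 h3 j (x + Pi.single μ 1) x').sub
    (tendsto_pieceCube hℓ hk ha0 h3 j x x')).abs.const_mul ((((ℓ + 1) ^ k : ℕ)) : ℝ))
  refine le_of_tendsto hconv (eventually_atTop.2 ⟨R₁ + R₂, fun t ht => ?_⟩)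
  have hxm := ctr_mem (d := d) hn (show R₁ ≤ t by omega) hx
  have hxm' := ctr_mem (d := d) hn (show R₁ ≤ t by omega) hx'
  have hxem := ctr_mem (d := d) hn (show R₂ ≤ t by omega) hxe
  have hrel : ctr ((ℓ + 1) ^ k) t (x + Pi.single μ 1) = ctr ((ℓ + 1) ^ k) t x + Pi.single μ 1 := ctr_add_vec _ t x _
  have hb := h k hk j hjk a m2 h1 h2 h3 h4 (cubeM t) (cubeM_pos t) μ ⟨_, hxm⟩ ⟨_, hxem⟩ hrel ⟨_, hxm'⟩
  rw [ctr_sub_ctr] at hb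
  simpa only [pieceCube, dif_pos (And.intro hxm hxm'), dif_pos (And.intro hxem hxm')] using hb

/-! ## §5 The concrete carrier of B3 (2.5)/(2.10)–(2.12) for `G_k(0)` on `ηℤ^{d+1}`, and `Ineq210` DISCHARGED -/

/-- kernel: `(s⁻¹)^{2−n} = s^n·s^{−2}` (real exponent). [folklore] -/
private theorem inv_rpow_two_sub {s : ℝ} (hs : 0 < s) (n : ℕ) :
    (s⁻¹) ^ ((2 : ℝ) - (n : ℝ)) = s ^ n * (s ^ 2)⁻¹ := by
  rw [Real.inv_rpow hs.le, Real.rpow_sub hs, Real.rpow_two, Real.rpow_natCast, inv_div, div_eq_mul_inv]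

/-- kernel: `(s⁻¹)^{1−n} = s^n·s^{−1}` (real exponent). [folklore] -/
private theorem inv_rpow_one_sub {s : ℝ} (hs : 0 < s) (n : ℕ) :
    (s⁻¹) ^ ((1 : ℝ) - (n : ℝ)) = s ^ n * s⁻¹ := by
  rw [Real.inv_rpow hs.le, Real.rpow_sub hs, Real.rpow_one, Real.rpow_natCast, inv_div, div_eq_mul_inv]

/-- **The concrete carrier of (2.5), (2.10)–(2.12) FOR PRINT'S §3 PROPAGATOR `G_k(0) = G_k(ηℤ^{d+1}, 0)`** at scale `k`
(`η = L^{−k}`, `L = ℓ + 1`, window point `(a, m²)`): `Site = ℤ^{d+1}` (the lattice `ηℤ^{d+1}` in lattice units), `dist(x,x′) =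
η|x − x′|_∞`, `L`, `η`, `d ↦ d + 1`; the (2.10) kernels in the PRINT'S `η^d`-normalisation: `absG j x x′ = η^{−(d+1)}|G^η_{(j)}(0)(x,x′)|`
with `G^η_{(j)}(0) = pieceLat j` ((2.6); `0` for `j ≥ k`), `absDG j μ x x′ = η^{−(d+1)}·η^{−1}|G^η_{(j)}(0)(x+ηe_μ,x′) − G^η_{(j)}(0)(x,x′)|`
(every bond of the lattice; zero field, so the covariant derivative is the plain forward difference).  DECLARED DIVERGENCE (F7), as
in `B3Ineq210ZeroBox.zeroBoxKernels`: the fields entering only (2.5), (2.11), (2.12) are NOT MODELLED (`Unit`/`0`); nothing is claimed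
about `Ineq25`/`Ineq211`/`Ineq212` of this instance — only `Ineq210` (`ineq210_zeroLattice`).
[cite: Balaban1983Higgs3, (2.6) p.424, (2.10) p.426] -/
def zeroLatticeKernels (d ℓ k : ℕ) (hℓ : 1 ≤ ℓ) (a m2 : ℝ) : ScaledKernels where
  Site := Fin (d + 1) → ℤ
  Bond := Unit
  Dir := Fin (d + 1)
  LocFn := Unit
  dist x x' := supNorm (x - x') / (((ℓ + 1) ^ k : ℕ) : ℝ)
  dist2 _ _ _ := 0
  distBlock _ _ _ := 0
  distSupp _ _ := 0
  distΩ₂ := 0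
  L := (ℓ : ℝ) + 1
  η := ((((ℓ + 1) ^ k : ℕ) : ℝ))⁻¹
  d := d + 1
  eRun := 0
  pRun := 0
  one_lt_L := one_lt_L_real hℓ
  η_pos := inv_pos.2 (by positivity)
  absG j x x' := ((((ℓ + 1) ^ k : ℕ) : ℝ)) ^ (d + 1) * |pieceLat ℓ k j a m2 x x'|
  absDG j μ x x' :=
    ((((ℓ + 1) ^ k : ℕ) : ℝ)) ^ (d + 1)
      * (((((ℓ + 1) ^ k : ℕ) : ℝ)) * |pieceLat ℓ k j a m2 (x + Pi.single μ 1) x' - pieceLat ℓ k j a m2 x x'|)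
  holderDiff _ _ _ _ _ := 0
  absGavg _ _ _ := 0
  normDeltaG _ _ _ := 0
  norm116 _ _ _ _ _ := 0

section Carrier

variable {ℓ k : ℕ} {hℓ : 1 ≤ ℓ} {a m2 : ℝ}

/-- the length scale `L^jη = s_j^{-1}` of the `j`-th piece (`j ≤ k`). [cite: Balaban1983Higgs3, (2.10) p.426] -/
theorem scale_eq_inv_sc {j : ℕ} (hj : j ≤ k) : (zeroLatticeKernels d ℓ k hℓ a m2).scale j = (sc ℓ k j)⁻¹ := by
  show ((ℓ : ℝ) + 1) ^ j * ((((ℓ + 1) ^ k : ℕ) : ℝ))⁻¹ = (sc ℓ k j)⁻¹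
  have h := sc_mul_bj (ℓ := ℓ) hj
  rw [bj_cast] at h
  have hs := (sc_pos ℓ k j).ne'
  have hL : (0 : ℝ) < ((ℓ : ℝ) + 1) ^ j := by positivity
  push_cast
  rw [← h]
  field_simp

/-- the length scales are positive. [cite: Balaban1983Higgs3, (2.10) p.426] -/
theorem scale_pos' (j : ℕ) : 0 < (zeroLatticeKernels d ℓ k hℓ a m2).scale j := by
  show 0 < ((ℓ : ℝ) + 1) ^ j * ((((ℓ + 1) ^ k : ℕ) : ℝ))⁻¹
  positivity

/-- `(L^jη)^{-1}·dist(x,x′) = |x − x′|_∞/L^j` (lattice units). [cite: Balaban1983Higgs3, (2.10) p.426] -/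
theorem scale_inv_mul_dist' {j : ℕ} (hj : j ≤ k) (x x' : Fin (d + 1) → ℤ) :
    ((zeroLatticeKernels d ℓ k hℓ a m2).scale j)⁻¹ * (zeroLatticeKernels d ℓ k hℓ a m2).dist x x'
      = supNorm (x - x') / ((bj ℓ j : ℕ) : ℝ) := by
  rw [scale_eq_inv_sc hj, inv_inv]
  show sc ℓ k j * (supNorm (x - x') / (((ℓ + 1) ^ k : ℕ) : ℝ)) = supNorm (x - x') / ((bj ℓ j : ℕ) : ℝ)
  have h := sc_mul_bj (ℓ := ℓ) hj
  rw [bj_cast] at h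
  have hs := (sc_pos ℓ k j).ne'
  have hL : (0 : ℝ) < ((ℓ : ℝ) + 1) ^ j := by positivity
  push_cast [bj_cast]
  rw [← h]
  field_simp

/-- kernel: `η^{−(d+1)}·L^{−j(d+1)} = s_j^{d+1}` (`L^k = s_jb_j`). [folklore] -/
private theorem Lk_pow_mul_inv_bj_pow {j : ℕ} (hj : j ≤ k) :
    ((((ℓ + 1) ^ k : ℕ) : ℝ)) ^ (d + 1) * ((((bj ℓ j : ℕ) : ℝ)) ^ (d + 1))⁻¹ = sc ℓ k j ^ (d + 1) := by
  have h := sc_mul_bj (ℓ := ℓ) hj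
  rw [bj_cast] at h
  have hL : (0 : ℝ) < ((ℓ : ℝ) + 1) ^ j := by positivity
  push_cast [bj_cast]
  rw [← h, mul_pow]
  field_simp

end Carrier

/-- **B3 (2.10) p. 426 [PDF 16] — `ScaledKernels.Ineq210 δ₁ C` DISCHARGED FOR PRINT'S §3 PROPAGATOR `G_k(0) = G_k(ηℤ^{d+1}, 0)`.**
Verbatim (p. 426): *"For the propagators G^η_{(j)} we apply the inequality
|G^η_{(j)}(Ω, B̃; x, x′)| ≤ O(1)(L^jη)^{−d+2}e^{−δ₁(L^jη)^{−1}|x−x′|}, (2.10) and if the propagator is differentiated, then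
for each differentiation, there is an additional factor (L^jη)^{−1} on the right side. … These inequalities will be used in the
next chapter."*; p. 433: *"with the scalar field propagator equal to G_k(0)"*; p. 434: *"We apply the decomposition (2.6) to the
propagators G_k(0), G_k"*.  HERE: there are `δ₁ > 0` and `C = O(1) > 0` depending only on `d + 1`, `L = ℓ + 1 ≥ 2` and the window
`[a₋,a₊] × [0,m²₊]` such that for EVERY scale `k ≥ 1` (`η = L^{−k}`) and every `(a, m²)` in the window the carrier
`zeroLatticeKernels` of the pieces `G^η_{(j)}(0)`, `0 ≤ j ≤ k − 1`, of the decomposition (2.6) of `G_k(0)` (`sum_pieceLat`)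
satisfies `Ineq210 δ₁ C` — value clause `(L^jη)^{2−(d+1)}`, once-differentiated clause `(L^jη)^{1−(d+1)}`, decay
`e^{−δ₁(L^jη)^{−1}dist(x,x′)}`, for ALL pairs of lattice points, uniformly in `k`.  HONEST SCOPE: (i) zero field (`U ≡ 1`, one
component), `Ω = ηℤ^{d+1}` — the printed §3 case after the p. 433 reductions; general `Ω ⊂ T_η`/regular `B̃` are the box/torus/
region members of the lineage; (ii) `G_k(0)` and its pieces are the KERNEL LIMITS of p03's `B3GkZeroLattice` construction along the
centred cubes (the product form `a_j²(L^jη)^{−4}G^η_jQ_j^*C^{(j)}Q_jG^η_j` of the LATTICE pieces is not claimed — only its box form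
`B3Ineq210ZeroBox.piece_eq_ACB` and the limit); (iii) sup norm for `|x − x′|`; (iv) constants existential (print: O(1), δ₁
absolute); (v) ROUTE = p03 g4's box clauses (the print's «rescaling … and application of Propositions I.2.1 and I.2.3» through
[B4] (2.34)/(2.35)/(2.37) at `A = 0`) + the infinite-volume limit. [cite: Balaban1983Higgs3, (2.10) p.426] -/
theorem ineq210_zeroLattice (d ℓ : ℕ) (hℓ : 1 ≤ ℓ) (amin aplus m2plus : ℝ) (ha : 0 < amin) :
    ∃ δ₁ C : ℝ, 0 < δ₁ ∧ 0 < C ∧ ∀ (k : ℕ), 1 ≤ k → ∀ (a m2 : ℝ), amin ≤ a → a ≤ aplus → 0 ≤ m2 →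
      m2 ≤ m2plus → (zeroLatticeKernels d ℓ k hℓ a m2).Ineq210 δ₁ C := by
  obtain ⟨δv, Cv, hδv, hCv, hV⟩ := abs_pieceLat_le d ℓ hℓ amin aplus m2plus ha
  obtain ⟨δd, Cd, hδd, hCd, hD⟩ := abs_pieceLatDiff_le d ℓ hℓ amin aplus m2plus ha
  refine ⟨min δv δd, Cv + Cd, lt_min hδv hδd, by linarith, ?_⟩
  intro k hk a m2 h1 h2 h3 h4 j x x'
  change (Fin (d + 1) → ℤ) at x x'
  have hn0 : 0 ≤ supNorm (x - x') := supNorm_nonneg _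
  have hsp : 0 < (zeroLatticeKernels d ℓ k hℓ a m2).scale j := scale_pos' j
  have hSd : ((zeroLatticeKernels d ℓ k hℓ a m2).d : ℝ) = ((d + 1 : ℕ) : ℝ) := rfl
  have hRHS2 : 0 ≤ (Cv + Cd) * (zeroLatticeKernels d ℓ k hℓ a m2).scale j ^ (2 - ((zeroLatticeKernels d ℓ k hℓ a m2).d : ℝ))
      * Real.exp (-(min δv δd * ((zeroLatticeKernels d ℓ k hℓ a m2).scale j)⁻¹
          * (zeroLatticeKernels d ℓ k hℓ a m2).dist x x')) :=
    mul_nonneg (mul_nonneg (by linarith) (Real.rpow_pos_of_pos hsp _).le) (Real.exp_pos _).le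
  have hRHS1 : 0 ≤ (Cv + Cd) * (zeroLatticeKernels d ℓ k hℓ a m2).scale j ^ (1 - ((zeroLatticeKernels d ℓ k hℓ a m2).d : ℝ))
      * Real.exp (-(min δv δd * ((zeroLatticeKernels d ℓ k hℓ a m2).scale j)⁻¹
          * (zeroLatticeKernels d ℓ k hℓ a m2).dist x x')) :=
    mul_nonneg (mul_nonneg (by linarith) (Real.rpow_pos_of_pos hsp _).le) (Real.exp_pos _).le
  rcases Nat.lt_or_ge j k with hjk | hkj
  · -- the pieces `j < k`
    have hj : j ≤ k := hjk.le
    have hb : (0 : ℝ) < ((bj ℓ j : ℕ) : ℝ) := by have := bj_pos ℓ j; positivity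
    have hexp : Real.exp (-(min δv δd * ((zeroLatticeKernels d ℓ k hℓ a m2).scale j)⁻¹
          * (zeroLatticeKernels d ℓ k hℓ a m2).dist x x'))
        = Real.exp (-(min δv δd * supNorm (x - x') / ((bj ℓ j : ℕ) : ℝ))) := by
      rw [mul_assoc, scale_inv_mul_dist' hj, mul_div_assoc]
    have hmono : ∀ {δ' : ℝ}, min δv δd ≤ δ' →
        Real.exp (-(δ' * supNorm (x - x') / ((bj ℓ j : ℕ) : ℝ)))
          ≤ Real.exp (-(min δv δd * supNorm (x - x') / ((bj ℓ j : ℕ) : ℝ))) := by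
      intro δ' hle
      apply Real.exp_le_exp.2
      rw [mul_div_assoc, mul_div_assoc]
      nlinarith [div_nonneg hn0 hb.le]
    refine ⟨?_, fun μ => ?_⟩
    · -- value clause
      have hv := hV k hk j hjk a m2 h1 h2 h3 h4 x x'
      rw [hexp, scale_eq_inv_sc hj, hSd, inv_rpow_two_sub (sc_pos ℓ k j)]
      show ((((ℓ + 1) ^ k : ℕ) : ℝ)) ^ (d + 1) * |pieceLat ℓ k j a m2 x x'| ≤ _
      calc ((((ℓ + 1) ^ k : ℕ) : ℝ)) ^ (d + 1) * |pieceLat ℓ k j a m2 x x'|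
          ≤ ((((ℓ + 1) ^ k : ℕ) : ℝ)) ^ (d + 1) * (Cv * ((((bj ℓ j : ℕ) : ℝ) ^ (d + 1))⁻¹ * (sc ℓ k j ^ 2)⁻¹)
              * Real.exp (-(δv * supNorm (x - x') / ((bj ℓ j : ℕ) : ℝ)))) :=
            mul_le_mul_of_nonneg_left hv (by positivity)
        _ = Cv * (sc ℓ k j ^ (d + 1) * (sc ℓ k j ^ 2)⁻¹)
              * Real.exp (-(δv * supNorm (x - x') / ((bj ℓ j : ℕ) : ℝ))) := by
            rw [← Lk_pow_mul_inv_bj_pow (d := d) hj]; ring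
        _ ≤ (Cv + Cd) * (sc ℓ k j ^ (d + 1) * (sc ℓ k j ^ 2)⁻¹)
              * Real.exp (-(min δv δd * supNorm (x - x') / ((bj ℓ j : ℕ) : ℝ))) := by
            have hq : 0 ≤ sc ℓ k j ^ (d + 1) * (sc ℓ k j ^ 2)⁻¹ := by
              have := sc_pos ℓ k j; positivity
            exact mul_le_mul (mul_le_mul_of_nonneg_right (by linarith) hq) (hmono (min_le_left _ _))
              (Real.exp_pos _).le (mul_nonneg (by linarith) hq)
    · -- derivative clause
      change Fin (d + 1) at μ
      have hd := hD k hk j hjk a m2 h1 h2 h3 h4 μ x x'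
      rw [hexp, scale_eq_inv_sc hj, hSd, inv_rpow_one_sub (sc_pos ℓ k j)]
      show ((((ℓ + 1) ^ k : ℕ) : ℝ)) ^ (d + 1)
          * (((((ℓ + 1) ^ k : ℕ) : ℝ)) * |pieceLat ℓ k j a m2 (x + Pi.single μ 1) x' - pieceLat ℓ k j a m2 x x'|) ≤ _
      calc ((((ℓ + 1) ^ k : ℕ) : ℝ)) ^ (d + 1)
            * (((((ℓ + 1) ^ k : ℕ) : ℝ)) * |pieceLat ℓ k j a m2 (x + Pi.single μ 1) x' - pieceLat ℓ k j a m2 x x'|)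
          ≤ ((((ℓ + 1) ^ k : ℕ) : ℝ)) ^ (d + 1) * (Cd * ((((bj ℓ j : ℕ) : ℝ) ^ (d + 1))⁻¹ * (sc ℓ k j)⁻¹)
              * Real.exp (-(δd * supNorm (x - x') / ((bj ℓ j : ℕ) : ℝ)))) :=
            mul_le_mul_of_nonneg_left hd (by positivity)
        _ = Cd * (sc ℓ k j ^ (d + 1) * (sc ℓ k j)⁻¹)
              * Real.exp (-(δd * supNorm (x - x') / ((bj ℓ j : ℕ) : ℝ))) := by
            rw [← Lk_pow_mul_inv_bj_pow (d := d) hj]; ring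
        _ ≤ (Cv + Cd) * (sc ℓ k j ^ (d + 1) * (sc ℓ k j)⁻¹)
              * Real.exp (-(min δv δd * supNorm (x - x') / ((bj ℓ j : ℕ) : ℝ))) := by
            have hq : 0 ≤ sc ℓ k j ^ (d + 1) * (sc ℓ k j)⁻¹ := by
              have := sc_pos ℓ k j; positivity
            exact mul_le_mul (mul_le_mul_of_nonneg_right (by linarith) hq) (hmono (min_le_right _ _))
              (Real.exp_pos _).le (mul_nonneg (by linarith) hq)
  · -- no pieces for `j ≥ k`
    have hj1 : 1 ≤ j := le_trans hk hkj
    have hp : ∀ y y' : Fin (d + 1) → ℤ, pieceLat ℓ k j a m2 y y' = 0 := fun y y' => pieceLat_of_le hj1 hkj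
    refine ⟨?_, fun μ => ?_⟩
    · show ((((ℓ + 1) ^ k : ℕ) : ℝ)) ^ (d + 1) * |pieceLat ℓ k j a m2 x x'| ≤ _
      rw [hp, abs_zero, mul_zero]
      exact hRHS2
    · change Fin (d + 1) at μ
      show ((((ℓ + 1) ^ k : ℕ) : ℝ)) ^ (d + 1)
          * (((((ℓ + 1) ^ k : ℕ) : ℝ)) * |pieceLat ℓ k j a m2 (x + Pi.single μ 1) x' - pieceLat ℓ k j a m2 x x'|) ≤ _
      rw [hp, hp, sub_zero, abs_zero, mul_zero, mul_zero]
      exact hRHS1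

/-! ## §6 Non-vacuity: the binders are inhabited (`d + 1 = 3`, `L = 2`, window `a ∈ [1/2, 2]`, `m² ∈ [0, 1]`, `k = 1`, `a = 1`,
`m² = 0`) -/

/-- **Non-vacuity witness**: (2.10) holds, with the constants of `ineq210_zeroLattice` for `d + 1 = 3`, `L = 2` and the window
`[1/2, 2] × [0, 1]`, for the instance `k = 1` (`η = 1/2`), `a = 1`, `m² = 0` on `ηℤ³`. [cite: Balaban1983Higgs3, (2.10) p.426] -/
theorem ineq210_zeroLattice_witness :
    ∃ δ₁ C : ℝ, 0 < δ₁ ∧ 0 < C ∧ (zeroLatticeKernels 2 1 1 le_rfl 1 0).Ineq210 δ₁ C := by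
  obtain ⟨δ₁, C, hδ, hC, h⟩ := ineq210_zeroLattice 2 1 le_rfl (1 / 2) 2 1 (by norm_num)
  exact ⟨δ₁, C, hδ, hC, h 1 le_rfl 1 0 (by norm_num) (by norm_num) le_rfl (by norm_num)⟩

/-! ## §7 (v1.1, append-only) The lattice Green identity of the SCALE-`j` propagators `𝒢_j` on `ηℤ^{d+1}`
(asked for by p39 g17 for the scale dictionary of (3.15)–(3.17) at a general external index) -/

section GreenScale

variable {ℓ k j : ℕ} {a m2 : ℝ}

/-- kernel: the centring shift `L^k t` is the shift by `L^{k−j}t` blocks of side `L^j` (`j ≤ k`). [folklore] -/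
private theorem ctr_eq_ctr_bj (hj : j ≤ k) (t : ℕ) (x : Fin (d + 1) → ℤ) :
    ctr ((ℓ + 1) ^ k) t x = ctr (bj ℓ j) ((ℓ + 1) ^ (k - j) * t) x := by
  funext i
  simp only [ctr_apply, bj]
  push_cast
  rw [← mul_assoc, ← pow_add, Nat.add_sub_cancel' hj]

/-- **THE SCALE-`j` BOX OPERATOR IS THE SCALE-`j` LATTICE OPERATOR AWAY FROM THE BOUNDARY** (`j ≤ k`): at a centred point all of
whose lattice neighbours lie in the fine box of `C_t`, the row of `fineOp_j` (`G_j^η(□)^{−1} = η^{−2}(−Δ^N_□) + m² + α_jP_j`,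
`B4Thm110ZeroBox.fineOp`) read through the centring is `s_j²` times the row of the lattice operator
`H_j = latOpK (L^j) a_j (m²s_j^{−2})` — i.e. `fineOp_j = (L^jη)^{−2}[L^{2j}(−Δ) + m²(L^jη)² + a_jQ_j^*Q_j]` on `ηℤ^{d+1}`
(the blocks of side `L^j` are aligned with the centring shift `L^kt = L^j·L^{k−j}t`; at `j = k` this is p03's `boxOpR_ctr_ctr`).
[cite: Balaban1983Higgs3, (2.6) p.424] -/
theorem fineOp_ctr_ctr (hj : j ≤ k) (a m2 : ℝ) {t : ℕ} {x z : Fin (d + 1) → ℤ}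
    (hx : ctr ((ℓ + 1) ^ k) t x ∈ boxDom (Nf ℓ k (cubeM t)))
    (hz : ctr ((ℓ + 1) ^ k) t z ∈ boxDom (Nf ℓ k (cubeM t)))
    (hN : ∀ w ∈ nbrs (ctr ((ℓ + 1) ^ k) t x), w ∈ boxDom (Nf ℓ k (cubeM t))) :
    fineOp ℓ k (cubeM t) j a m2 ⟨ctr ((ℓ + 1) ^ k) t x, hx⟩ ⟨ctr ((ℓ + 1) ^ k) t z, hz⟩
      = sc ℓ k j ^ 2 * latOpK (bj ℓ j) (B1.aSeq a ((ℓ : ℝ) + 1) j) (m2 / sc ℓ k j ^ 2) x z := by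
  have hinj : (ctr ((ℓ + 1) ^ k) t z = ctr ((ℓ + 1) ^ k) t x) ↔ z = x := (add_left_injective _).eq_iff
  have hnb : ctr ((ℓ + 1) ^ k) t z ∈ nbrs (ctr ((ℓ + 1) ^ k) t x) ↔ z ∈ nbrs x := by
    unfold ctr; rw [mem_nbrs_add_iff]; simp
  have hbl : (blk (bj ℓ j) (ctr ((ℓ + 1) ^ k) t z) = blk (bj ℓ j) (ctr ((ℓ + 1) ^ k) t x))
      ↔ blk (bj ℓ j) z = blk (bj ℓ j) x := by
    rw [ctr_eq_ctr_bj hj, ctr_eq_ctr_bj hj, blk_ctr (bj_pos ℓ j), blk_ctr (bj_pos ℓ j)]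
    exact (add_left_injective _).eq_iff
  have e1 : (neumannLapK (Nf ℓ k (cubeM (d := d) t)) (ctr ((ℓ + 1) ^ k) t x) (ctr ((ℓ + 1) ^ k) t z) : ℝ)
      = lapK x z := by
    by_cases hzx : z = x
    · subst hzx
      simp only [neumannLapK, lapK, if_true]
      rw [Finset.filter_true_of_mem hN, card_nbrs]
    · have h1 : ctr ((ℓ + 1) ^ k) t z ≠ ctr ((ℓ + 1) ^ k) t x := fun h => hzx (hinj.1 h)
      by_cases hzn : z ∈ nbrs x
      · simp [neumannLapK, lapK, h1, hzx, hnb.2 hzn, hzn]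
      · simp [neumannLapK, lapK, h1, hzx, mt hnb.1 hzn, hzn]
  have e2 : (diagK m2 (ctr ((ℓ + 1) ^ k) t x) (ctr ((ℓ + 1) ^ k) t z) : ℝ)
      = sc ℓ k j ^ 2 * diagK (m2 / sc ℓ k j ^ 2) x z := by
    have hsc : sc ℓ k j ≠ 0 := (sc_pos ℓ k j).ne'
    by_cases hzx : z = x
    · subst hzx; simp only [diagK, if_true]; field_simp
    · simp [diagK, hzx, mt hinj.1 hzx]
  have e3 : (avgK (αj a ℓ k j * (((bj ℓ j : ℝ)) ^ (d + 1))⁻¹) (bj ℓ j) (ctr ((ℓ + 1) ^ k) t x)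
        (ctr ((ℓ + 1) ^ k) t z) : ℝ)
      = sc ℓ k j ^ 2 * avgK (B1.aSeq a ((ℓ : ℝ) + 1) j * ((((bj ℓ j : ℕ) : ℝ)) ^ (d + 1))⁻¹) (bj ℓ j) x z := by
    by_cases hzb : blk (bj ℓ j) z = blk (bj ℓ j) x
    · simp only [avgK, hzb, hbl.2 hzb, if_true, αj]; ring
    · simp [avgK, hzb, mt hbl.1 hzb]
  have hLk : ((((ℓ + 1) ^ k : ℕ) : ℝ)) ^ 2 = sc ℓ k j ^ 2 * ((bj ℓ j : ℝ)) ^ 2 := by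
    rw [← mul_pow, sc_mul_bj hj]; push_cast; ring
  simp only [fineOp, opBoxR, Matrix.of_apply, latOpK]
  rw [e1, e2, e3, hLk]
  ring

/-- **THE GREEN IDENTITY OF THE SCALE-`j` CUBE PROPAGATORS READ ON THE LATTICE** (`1 ≤ j < k`): for `t` so large that the
whole scale-`k` operator support of `x` sits in `C_t` and `x′ ∈ C_t`,
`Σ_z s_j²H_j(x,z)·g^{(j)}_t(z,x′) = δ_{x,x′}` — the box identity `fineOp_j·G_j = 1` (`B4Thm110ZeroBox.fineOp_mul_Gfine`) at an
interior row, read through `fineOp_ctr_ctr`. [cite: Balaban1983Higgs3, (2.6) p.424] -/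
theorem green_gscale (hℓ : 1 ≤ ℓ) (hj1 : 1 ≤ j) (hj : j + 1 ≤ k) (ha : 0 < a) (hm : 0 ≤ m2) {t : ℕ}
    {x x' : Fin (d + 1) → ℤ} (hx : ∀ i, |x i| + (((ℓ + 1) ^ k : ℕ) : ℤ) ≤ (((ℓ + 1) ^ k : ℕ) : ℤ) * t)
    (hx' : ctr ((ℓ + 1) ^ k) t x' ∈ boxDom (Nf ℓ k (cubeM (d := d) t))) :
    ∑ z ∈ opSupp (bj ℓ j) x,
        (sc ℓ k j ^ 2 * latOpK (bj ℓ j) (B1.aSeq a ((ℓ : ℝ) + 1) j) (m2 / sc ℓ k j ^ 2) x z) * gscale ℓ k j t a m2 z x'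
      = if x = x' then 1 else 0 := by
  have hjk : j ≤ k := by omega
  have hn : 1 ≤ (ℓ + 1) ^ k := Nat.one_le_pow _ _ (by omega)
  have hb : 1 ≤ bj ℓ j := bj_pos ℓ j
  have hbk : ((bj ℓ j : ℕ) : ℤ) ≤ (((ℓ + 1) ^ k : ℕ) : ℤ) := by
    exact_mod_cast Nat.pow_le_pow_right (by omega) hjk
  have hsupp : ∀ z ∈ opSupp (bj ℓ j) x, ctr ((ℓ + 1) ^ k) t z ∈ boxDom (Nf ℓ k (cubeM (d := d) t)) := fun z hz =>
    ctr_mem_of_abs_le (d := d) hn (fun i => by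
      have h1 := abs_le_of_mem_opSupp hb hz i
      have h2 := hx i
      linarith)
  have hxs : x ∈ opSupp (bj ℓ j) x := by simp [opSupp]
  have hxm : ctr ((ℓ + 1) ^ k) t x ∈ boxDom (Nf ℓ k (cubeM (d := d) t)) := hsupp x hxs
  have hcw : ∀ w : Fin (d + 1) → ℤ, ctr ((ℓ + 1) ^ k) t (w - fun _ => ((((ℓ + 1) ^ k : ℕ)) : ℤ) * (t : ℤ)) = w :=
    fun w => by funext i; simp [ctr]
  -- all lattice neighbours of `ctr x` are in the box (they are centred points of the scale-`k` support of `x`)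
  have hN : ∀ w ∈ nbrs (ctr ((ℓ + 1) ^ k) t x), w ∈ boxDom (Nf ℓ k (cubeM (d := d) t)) := by
    intro w hw
    have h1 : (w - fun _ => ((((ℓ + 1) ^ k : ℕ)) : ℤ) * (t : ℤ)) ∈ nbrs x := by
      rw [← mem_nbrs_add_iff]; exact hw
    have h2 : ctr ((ℓ + 1) ^ k) t (w - fun _ => ((((ℓ + 1) ^ k : ℕ)) : ℤ) * (t : ℤ)) ∈ boxDom (Nf ℓ k (cubeM (d := d) t)) :=
      ctr_mem_of_abs_le (d := d) hn (fun i => by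
        have h3 := abs_le_of_mem_opSupp hn (Finset.mem_union_left _ (Finset.mem_insert_of_mem h1)) i
        have h4 := hx i
        linarith)
    rwa [hcw] at h2
  have hmat := fineOp_mul_Gfine hℓ hj1 hj (cubeM_pos (d := d) t) ha hm (M := cubeM (d := d) t)
  have happ : (fineOp ℓ k (cubeM (d := d) t) j a m2 * Gfine ℓ k (cubeM (d := d) t) j a m2)
      ⟨ctr ((ℓ + 1) ^ k) t x, hxm⟩ ⟨ctr ((ℓ + 1) ^ k) t x', hx'⟩ = if x = x' then 1 else 0 := by
    rw [hmat, Matrix.one_apply]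
    have : (⟨ctr ((ℓ + 1) ^ k) t x, hxm⟩ : ↥(boxDom (Nf ℓ k (cubeM (d := d) t)))) = ⟨ctr ((ℓ + 1) ^ k) t x', hx'⟩ ↔ x = x' := by
      rw [Subtype.mk.injEq]; exact (add_left_injective _).eq_iff
    simp only [this]
  rw [Matrix.mul_apply] at happ
  rw [← happ]
  -- read the box row on the lattice
  set c : Fin (d + 1) → ℤ := fun _ => ((((ℓ + 1) ^ k : ℕ)) : ℤ) * (t : ℤ) with hc
  set H : (Fin (d + 1) → ℤ) → (Fin (d + 1) → ℤ) → ℝ := fun y z =>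
    sc ℓ k j ^ 2 * latOpK (bj ℓ j) (B1.aSeq a ((ℓ : ℝ) + 1) j) (m2 / sc ℓ k j ^ 2) y z with hH
  set gl : (Fin (d + 1) → ℤ) → ℝ := fun w =>
    if h : w ∈ boxDom (Nf ℓ k (cubeM (d := d) t)) then
      Gfine ℓ k (cubeM (d := d) t) j a m2 ⟨w, h⟩ ⟨ctr ((ℓ + 1) ^ k) t x', hx'⟩ else 0 with hgl
  have step1 : ∑ Y : ↥(boxDom (Nf ℓ k (cubeM (d := d) t))),
      fineOp ℓ k (cubeM (d := d) t) j a m2 ⟨ctr ((ℓ + 1) ^ k) t x, hxm⟩ Y * Gfine ℓ k (cubeM (d := d) t) j a m2 Y ⟨ctr ((ℓ + 1) ^ k) t x', hx'⟩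
      = ∑ Y : ↥(boxDom (Nf ℓ k (cubeM (d := d) t))), H x (Y.1 - c) * gl Y.1 := by
    refine Finset.sum_congr rfl fun Y _ => ?_
    have hY : Y = ⟨ctr ((ℓ + 1) ^ k) t (Y.1 - c), by rw [hcw]; exact Y.2⟩ := Subtype.ext (hcw Y.1).symm
    have hgY : gl Y.1 = Gfine ℓ k (cubeM (d := d) t) j a m2 Y ⟨ctr ((ℓ + 1) ^ k) t x', hx'⟩ := by
      rw [hgl]; simp only [Y.2, dif_pos]
    rw [hgY]
    congr 1
    conv_lhs => rw [hY]
    exact fineOp_ctr_ctr hjk a m2 hxm _ hN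
  have step2 : ∑ Y : ↥(boxDom (Nf ℓ k (cubeM (d := d) t))), H x (Y.1 - c) * gl Y.1
      = ∑ w ∈ boxDom (Nf ℓ k (cubeM (d := d) t)), H x (w - c) * gl w :=
    Finset.sum_coe_sort (boxDom (Nf ℓ k (cubeM (d := d) t))) (fun w => H x (w - c) * gl w)
  have himg : (opSupp (bj ℓ j) x).image (fun z => z + c) ⊆ boxDom (Nf ℓ k (cubeM (d := d) t)) := by
    intro w hw
    obtain ⟨z, hz, rfl⟩ := Finset.mem_image.1 hw
    exact hsupp z hz
  have step3 : ∑ w ∈ (opSupp (bj ℓ j) x).image (fun z => z + c), H x (w - c) * gl w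
      = ∑ w ∈ boxDom (Nf ℓ k (cubeM (d := d) t)), H x (w - c) * gl w := by
    refine Finset.sum_subset himg fun w _ hw => ?_
    have hz : w - c ∉ opSupp (bj ℓ j) x := fun h =>
      hw (Finset.mem_image.2 ⟨w - c, h, sub_add_cancel w c⟩)
    rw [hH]
    simp only [latOpK_eq_zero hb _ _ hz, mul_zero, zero_mul]
  have step4 : ∑ w ∈ (opSupp (bj ℓ j) x).image (fun z => z + c), H x (w - c) * gl w
      = ∑ z ∈ opSupp (bj ℓ j) x, H x (z + c - c) * gl (z + c) :=
    Finset.sum_image fun z _ z' _ h => add_left_injective c h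
  rw [step1, step2, ← step3, step4]
  refine Finset.sum_congr rfl fun z hz => ?_
  rw [add_sub_cancel_right]
  congr 1
  have hzc : z + c = ctr ((ℓ + 1) ^ k) t z := rfl
  rw [gscale_eq (hsupp z hz) hx', hgl]
  simp only [hzc, hsupp z hz, dif_pos]

/-- **`𝒢_j` IS `s_j^{−2}` TIMES THE GREEN'S FUNCTION OF THE SCALE-`j` OPERATOR ON `ηℤ^{d+1}`** (`1 ≤ j ≤ k`): for all lattice
points `x, x′`, `Σ_z H_j(x,z)·𝒢_j(z,x′) = s_j^{−2}δ_{x,x′}` with `H_j = latOpK (L^j) a_j (m²s_j^{−2})` (blocks of side `L^j`,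
running constant `a_j`, mass `m²/s_j²`, `s_j = L^{k−j} = (L^jη)^{−1}`) — the (2.6)-statement «the pieces are differences of
rescaled lower-step propagators» at the level of lattice equations: `𝒢_j` is the `j`-th renormalization step's propagator
`G_j(0)` rescaled to the `η`-lattice; at `j = k` it is p03's `green_GkLat`. (By the limit along the centred cubes of
`green_gscale`.) [cite: Balaban1983Higgs3, (2.6) p.424] -/
theorem green_GscaleLat (hℓ : 1 ≤ ℓ) (hk : 1 ≤ k) (hj1 : 1 ≤ j) (hjk : j ≤ k) (ha : 0 < a) (hm : 0 ≤ m2)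
    (x x' : Fin (d + 1) → ℤ) :
    ∑ z ∈ opSupp (bj ℓ j) x, latOpK (bj ℓ j) (B1.aSeq a ((ℓ : ℝ) + 1) j) (m2 / sc ℓ k j ^ 2) x z * GscaleLat ℓ k j a m2 z x'
      = if x = x' then (sc ℓ k j ^ 2)⁻¹ else 0 := by
  rcases Nat.lt_or_ge j k with hlt | hge
  · have hj : j + 1 ≤ k := hlt
    have hn : 1 ≤ (ℓ + 1) ^ k := Nat.one_le_pow _ _ (by omega)
    have hsc2 : sc ℓ k j ^ 2 ≠ 0 := (pow_pos (sc_pos ℓ k j) 2).ne'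
    set T : ℕ := ∑ i, (x i).natAbs + ∑ i, (x' i).natAbs + 1 with hT
    have hTeq : (T : ℤ) = ∑ i, |x i| + ∑ i, |x' i| + 1 := by rw [hT]; push_cast; ring
    have hS : 0 ≤ ∑ i, |x i| := Finset.sum_nonneg fun i _ => abs_nonneg (x i)
    have hS' : 0 ≤ ∑ i, |x' i| := Finset.sum_nonneg fun i _ => abs_nonneg (x' i)
    have hxT : ∀ i, |x i| + 1 ≤ (T : ℤ) := fun i => by
      have h1 : |x i| ≤ ∑ j, |x j| :=
        Finset.single_le_sum (f := fun j => |x j|) (fun j _ => abs_nonneg (x j)) (Finset.mem_univ i)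
      rw [hTeq]; linarith
    have hxT' : ∀ i, |x' i| ≤ (T : ℤ) := fun i => by
      have h1 : |x' i| ≤ ∑ j, |x' j| :=
        Finset.single_le_sum (f := fun j => |x' j|) (fun j _ => abs_nonneg (x' j)) (Finset.mem_univ i)
      rw [hTeq]; linarith
    set S : ℝ := ∑ z ∈ opSupp (bj ℓ j) x,
      latOpK (bj ℓ j) (B1.aSeq a ((ℓ : ℝ) + 1) j) (m2 / sc ℓ k j ^ 2) x z * GscaleLat ℓ k j a m2 z x' with hSdef
    have hlim : Tendsto (fun t => ∑ z ∈ opSupp (bj ℓ j) x,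
        (sc ℓ k j ^ 2 * latOpK (bj ℓ j) (B1.aSeq a ((ℓ : ℝ) + 1) j) (m2 / sc ℓ k j ^ 2) x z) * gscale ℓ k j t a m2 z x')
        atTop (𝓝 (∑ z ∈ opSupp (bj ℓ j) x,
          (sc ℓ k j ^ 2 * latOpK (bj ℓ j) (B1.aSeq a ((ℓ : ℝ) + 1) j) (m2 / sc ℓ k j ^ 2) x z)
            * GscaleLat ℓ k j a m2 z x')) :=
      tendsto_finsetSum _ fun z _ => (tendsto_gscale hℓ hk hj1 hjk ha hm z x').const_mul _
    have hev : ∀ t, T ≤ t → (∑ z ∈ opSupp (bj ℓ j) x,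
        (sc ℓ k j ^ 2 * latOpK (bj ℓ j) (B1.aSeq a ((ℓ : ℝ) + 1) j) (m2 / sc ℓ k j ^ 2) x z) * gscale ℓ k j t a m2 z x')
          = if x = x' then 1 else 0 := by
      intro t ht
      have ht' : (T : ℤ) ≤ t := by exact_mod_cast ht
      have hn1 : (1 : ℤ) ≤ (((ℓ + 1) ^ k : ℕ) : ℤ) := by exact_mod_cast hn
      refine green_gscale hℓ hj1 hj ha hm (fun i => ?_) (ctr_mem_of_abs_le (d := d) hn fun i => ?_)
      · have := abs_nonneg (x i); nlinarith [hxT i]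
      · nlinarith [hxT' i, abs_nonneg (x' i)]
    have hδ : ∑ z ∈ opSupp (bj ℓ j) x,
        (sc ℓ k j ^ 2 * latOpK (bj ℓ j) (B1.aSeq a ((ℓ : ℝ) + 1) j) (m2 / sc ℓ k j ^ 2) x z) * GscaleLat ℓ k j a m2 z x'
          = if x = x' then 1 else 0 :=
      tendsto_nhds_unique hlim (tendsto_const_nhds.congr' (eventually_atTop.2 ⟨T, fun t ht => (hev t ht).symm⟩))
    have hmul : sc ℓ k j ^ 2 * S = if x = x' then 1 else 0 := by
      rw [← hδ, hSdef, Finset.mul_sum]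
      exact Finset.sum_congr rfl fun z _ => by ring
    calc S = (sc ℓ k j ^ 2)⁻¹ * (sc ℓ k j ^ 2 * S) := by rw [← mul_assoc, inv_mul_cancel₀ hsc2, one_mul]
      _ = (sc ℓ k j ^ 2)⁻¹ * (if x = x' then 1 else 0) := by rw [hmul]
      _ = if x = x' then (sc ℓ k j ^ 2)⁻¹ else 0 := by split_ifs <;> simp
  · -- `j = k`: `𝒢_k = G_k(0)`, `s_k = 1`, `b_k = L^k`
    have hjk' : j = k := le_antisymm hjk hge
    subst hjk'
    have h := green_GkLat hℓ hk ha hm x x'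
    simp only [sc_self, one_pow, div_one, inv_one]
    exact h

/-- the partial sums of (2.6): `𝒢_n = Σ_{j<n} G^η_{(j)}(0)` for `1 ≤ n ≤ k` (`sum_pieceLat` is `n = k`).
[cite: Balaban1983Higgs3, (2.6) p.424] -/
theorem GscaleLat_eq_sum_pieceLat {n : ℕ} (hn : 1 ≤ n) (hnk : n ≤ k) (x x' : Fin (d + 1) → ℤ) :
    GscaleLat ℓ k n a m2 x x' = ∑ j ∈ Finset.range n, pieceLat ℓ k j a m2 x x' := by
  induction n, hn using Nat.le_induction with
  | base => rw [Finset.sum_range_one, pieceLat_zero]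
  | succ n hn ih => rw [Finset.sum_range_succ, ← ih (by omega), pieceLat_of_pos hn hnk, add_sub_cancel]

/-- **EXPONENTIAL ROW BOUND FOR `𝒢_n`** (lattice units): there are `δ₁, C > 0` (window constants) with
`|𝒢_n(x,x′)| ≤ C·n·e^{−δ₁|x−x′|_∞/L^{n−1}}` for every `k ≥ 1`, `1 ≤ n ≤ k`, window point and ALL `x, x′ ∈ ℤ^{d+1}` — each of the `n`
pieces `G^η_{(j)}(0)`, `j < n`, is bounded by `C·L^{−j(d+1)}s_j^{−2}e^{−δ₁|x−x′|_∞/L^j} ≤ C·e^{−δ₁|x−x′|_∞/L^{n−1}}` (`abs_pieceLat_le`); in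
particular the rows of `𝒢_n` are absolutely summable (what the uniqueness-by-pairing dictionary of p39 needs).
[cite: Balaban1983Higgs3, (2.6) p.424, (2.10) p.426] -/
theorem abs_GscaleLat_le (d ℓ : ℕ) (hℓ : 1 ≤ ℓ) (amin aplus m2plus : ℝ) (ha : 0 < amin) :
    ∃ δ₁ C : ℝ, 0 < δ₁ ∧ 0 < C ∧ ∀ (k : ℕ), 1 ≤ k → ∀ (n : ℕ), 1 ≤ n → n ≤ k → ∀ (a m2 : ℝ), amin ≤ a → a ≤ aplus →
      0 ≤ m2 → m2 ≤ m2plus → ∀ (x x' : Fin (d + 1) → ℤ),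
        |GscaleLat ℓ k n a m2 x x'| ≤ C * n * Real.exp (-(δ₁ * supNorm (x - x') / ((bj ℓ (n - 1) : ℕ) : ℝ))) := by
  obtain ⟨δ₁, C, hδ₁, hC, h⟩ := abs_pieceLat_le d ℓ hℓ amin aplus m2plus ha
  refine ⟨δ₁, C, hδ₁, hC, ?_⟩
  intro k hk n hn hnk a m2 h1 h2 h3 h4 x x'
  have hS : 0 ≤ supNorm (x - x') := supNorm_nonneg _
  -- each piece `j < n` is below `C·e^{−δ₁|x−x′|/L^{n−1}}`
  have hpiece : ∀ j ∈ Finset.range n,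
      |pieceLat ℓ k j a m2 x x'| ≤ C * Real.exp (-(δ₁ * supNorm (x - x') / ((bj ℓ (n - 1) : ℕ) : ℝ))) := by
    intro j hj
    have hjn : j < n := Finset.mem_range.1 hj
    have hb := h k hk j (by omega) a m2 h1 h2 h3 h4 x x'
    have hbj1 : (1 : ℝ) ≤ ((bj ℓ j : ℕ) : ℝ) := by exact_mod_cast bj_pos ℓ j
    have hbjn : ((bj ℓ j : ℕ) : ℝ) ≤ ((bj ℓ (n - 1) : ℕ) : ℝ) := by
      exact_mod_cast Nat.pow_le_pow_right (by omega) (by omega)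
    have hbpos : (0 : ℝ) < ((bj ℓ j : ℕ) : ℝ) := by positivity
    have hfac : ((((bj ℓ j : ℕ) : ℝ) ^ (d + 1))⁻¹ * (sc ℓ k j ^ 2)⁻¹) ≤ 1 := by
      have h1' : 1 ≤ (((bj ℓ j : ℕ) : ℝ)) ^ (d + 1) := one_le_pow₀ hbj1
      have h2' : 1 ≤ sc ℓ k j ^ 2 := one_le_pow₀ (one_le_sc ℓ k j)
      calc ((((bj ℓ j : ℕ) : ℝ) ^ (d + 1))⁻¹ * (sc ℓ k j ^ 2)⁻¹) ≤ 1 * 1 :=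
            mul_le_mul (inv_le_one_of_one_le₀ h1') (inv_le_one_of_one_le₀ h2') (by positivity) zero_le_one
        _ = 1 := one_mul _
    have hexp : Real.exp (-(δ₁ * supNorm (x - x') / ((bj ℓ j : ℕ) : ℝ)))
        ≤ Real.exp (-(δ₁ * supNorm (x - x') / ((bj ℓ (n - 1) : ℕ) : ℝ))) := by
      rw [Real.exp_le_exp, neg_le_neg_iff]
      exact div_le_div_of_nonneg_left (by positivity) hbpos hbjn
    calc |pieceLat ℓ k j a m2 x x'|
        ≤ C * ((((bj ℓ j : ℕ) : ℝ) ^ (d + 1))⁻¹ * (sc ℓ k j ^ 2)⁻¹)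
            * Real.exp (-(δ₁ * supNorm (x - x') / ((bj ℓ j : ℕ) : ℝ))) := hb
      _ ≤ C * 1 * Real.exp (-(δ₁ * supNorm (x - x') / ((bj ℓ (n - 1) : ℕ) : ℝ))) :=
          mul_le_mul (mul_le_mul_of_nonneg_left hfac hC.le) hexp (by positivity) (by positivity)
      _ = C * Real.exp (-(δ₁ * supNorm (x - x') / ((bj ℓ (n - 1) : ℕ) : ℝ))) := by rw [mul_one]
  rw [GscaleLat_eq_sum_pieceLat hn hnk]
  calc |∑ j ∈ Finset.range n, pieceLat ℓ k j a m2 x x'| ≤ ∑ j ∈ Finset.range n, |pieceLat ℓ k j a m2 x x'| :=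
        Finset.abs_sum_le_sum_abs _ _
    _ ≤ ∑ _j ∈ Finset.range n, C * Real.exp (-(δ₁ * supNorm (x - x') / ((bj ℓ (n - 1) : ℕ) : ℝ))) :=
        Finset.sum_le_sum hpiece
    _ = C * n * Real.exp (-(δ₁ * supNorm (x - x') / ((bj ℓ (n - 1) : ℕ) : ℝ))) := by
        rw [Finset.sum_const, Finset.card_range, nsmul_eq_mul]; ring

end GreenScale

end

end Literature.MathematicalPhysics.QuantumFieldTheory.Balaban1983to89.B3Ineq210ZeroLattice
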